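import Summits.QuantumFields.YangMills.Theorems.WeakCouplingHypercubicLimitRP.Negative.SummitTie
import Summits.QuantumFields.YangMills.Theorems.PencilRigidityWeakCouplingHypercubicLimitRPOfRpCoreDisjoint
import Summits.QuantumFields.YangMills.Theorems.HypercubicLimit.Negative.NonabelianLoadBearing
import Summits.QuantumFields.YangMills.Theorems.MirrorModularBoostsHypercubicLimitPlaneLimitsDefs
import Summits.QuantumFields.YangMills.Theorems.MirrorModularBoostsHypercubicLimitClosureHalvesDefs
import Summits.QuantumFields.YangMills.Theorems.PencilRigidityDiagonalMirrorRPRStubRpClosureDefs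
import Summits.QuantumFields.YangMills.Theorems.DiagonalMirrorRPROddTorusSwapPairingDefs
import Summits.QuantumFields.YangMills.Theorems.PencilRigidityWeakCouplingHypercubicLimitRPDiagRPOfSwapPairing
import Summits.QuantumFields.YangMills.Theorems.MirrorModularBoostsHypercubicLimitPlaneLimitsOfBound
import Summits.QuantumFields.YangMills.Theorems.DiagonalMirrorRPRFamObsGrowth
import Summits.QuantumFields.YangMills.Theorems.WeakCouplingHypercubicLimitRP.Negative.OddTorusSwapPairingLiminf
import Summits.QuantumFields.YangMills.Theorems.DiagonalMirrorRPRTwistLettersDefs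
import Summits.QuantumFields.YangMills.Theorems.DiagonalMirrorRPRCubePairing
import Summits.QuantumFields.YangMills.Theorems.PencilRigidityWeakCouplingHypercubicLimitRPDiagRPOfTwistLetters
import Summits.QuantumFields.YangMills.Theorems.PencilRigidityWeakCouplingHypercubicLimitRPOfCubeDecoupling

/-!
# Disproof work file — crux `WeakCouplingHypercubicLimitRP` (stmt-QuantumFields-27398): the registered lattice stub **D1′**
`stub_oddTorusSwapPairingLiminf` (skeleton of record `Cruxes/WeakCouplingHypercubicLimitRP/Lines/Sketch.lean` v2 = ρ1 reshape,
sha16 `97b02a6fc0a363ac`, l.1650–1663) and its predecessor **D1** `stub_diagRPOfPlaneLimits` (v1 `7bf38c709623ad77` l.1618–1625;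
in v2 the THEOREM `diagRPOfPlaneLimits_of_stubs` = D1′ + the landed transfer p827255)

Standing disprover `cdisprove-27398-1`: generation 0 wrote §1–§4 (target D1), generation 2 (2026-08-31) adds §5–§7 (target D1′
BY NAME, O4 WORD 22) and census v2, generation 3 (2026-08-31, after PICKED.md r1) adds §8–§11 (the LETTERS of doors B and C at the
junk group; S6i's simplicity hypothesis load-bearing; landed def-free as `Theorems/…/Negative/LettersJunkGroup.lean`) and census v3.
This file ELABORATES (rc 0, no `sorry`, no warnings; axioms ⊆ {propext, Classical.choice,
Quot.sound}). Prose lives in docstrings; every `theorem` below is kernel-checked.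

## §0 VERDICT (v3 ⊇ v2)
**g3: still no disproof of D1′; the letters of BOTH doors are junk-closed; S6i is false without `IsCompactSimpleLieGroup G`.**
(§8) door B's letters `TwistLetters r sch` (= ∃ 𝔪 : DiagonalSliceModel r sch, OddTwistGap 𝔪 ∧ DiagLukewarm 𝔪) HOLD at every
one-element gauge group, every `LatticeRep`, every scheme — witness the rank-one VACUUM slice model `vacuumSliceModel` (even sector
one mode of modulus 1, odd sector empty, Gram weight = the Gram pairing = `(famObs)²` there, depth 1); (§9) door C's letter
`AdmissibleCubeDecoupling r sch` HOLDS there too (free-cube and torus `n`-point functions coincide; `R = L`); (§10) at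
`(PUnit, punitRep, weakScheme)` ALL five scheme-level binders of D1″, BOTH doors' letters and the socket hold SIMULTANEOUSLY
(`letters_jointly_satisfiable_at_punit`), and both landed bridges compose there (`socket_via_doorB_at_punit`, `socket_via_doorC_at_punit`)
— so no letter, and no combination of letters with binders, is refutable by scheme-level or junk-group reasoning; a kill of either
door needs genuinely nonabelian finite-size input (census v3 ρ7: the U-odd / seam residual, untyped). (§11) S6i `stub_rpCoreDisjoint`
with its hypothesis `IsCompactSimpleLieGroup G` dropped (`S6iWithoutSimple`) is FALSE (`rpCoreDisjoint_false_without_simple`): at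
`G = PUnit` the connected three-point combination of the `κ₃` floor vanishes IDENTICALLY at every step for every `r`, `sch`, `f g h`
(`kappaThree_eq_zero_of_subsingleton`), while every other conjunct of S6i holds there (§10) — the floor is the unique group-sensitive
conjunct of the whole line at the junk group; S6i itself (uniform lattice gap + UFB + `κ₃` floor at weak coupling for compact simple
`G`) is the open problem and was not attacked (units check: `RPSpectral`'s rate `e^{−Δ a_k n}` is physical — no mis-statement).
v2 verdict, unchanged: **No disproof found in ρ1 — for D1′ as for D1.** D1′ AS TYPED survives every cheap attack in the census. PROVED instead:
(§5) `D1'` verbatim, `D1_of_D1'` (re-derivation of the v2 theorem D1 through p827255), `weakCouplingHypercubicLimitRP_of_D1'_of_S6i`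
(the crux by name from the two v2 stubs: the binder types attacked here ARE the registered ones);
(§6) **DECORATION**: `D1'_iff_D1''` — the subsequence `φ`, the limit family `T` and the hypothesis `PlaneLimits r sch φ T` are INERT
in D1′: D1′ is equivalent to the scheme-level statement `D1''` = «every admissible weak-coupling scheme (`HasWeakCouplingLimit`,
`PolyVolume`, `PolyRenorm`, `UniformFunctionalBoundPlanes`, `RPSpectral` gap) is asymptotically swap-reflection-positive on its OWN
odd tori in the curvature channel (`OddTorusSwapPairingLiminf r sch`, liminf over the FULL sequence)». Tools: `rpSpectral_subseq`,
the subsequence principle `liminf_nonneg_of_subseq`, and the LANDED Z2 `stub_planeLimits` (UFB ⇒ plane limits exist along a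
sub-subsequence). So a counterexample to D1′ is an admissible scheme whose own-torus swap Gram pairing stays ≤ −ε along a
subsequence — a statement about Wilson's lattice measures only (finite-size / seam control under the gap), with no continuum
object in it; conversely nothing about `T` can be used for or against D1′. (Contrast §3: for D1 the lattice origin of `T₃` was
load-bearing; for D1′ `PlaneLimits` is removable.)
(§7) junk-`G` door CLOSED for D1′: `oddTorusSwapPairingLiminf_of_subsingleton` — at every one-element gauge group the pairing at
step `k` is the perfect square `(Σᵢ cᵢ ⟨∏ⱼ Φ(fᵢⱼ)⟩_k)²` (swap covariance p827142 + factorisation), so D1″/D1′ hold there with NO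
hypothesis; the absent `IsCompactSimpleLieGroup G` is not exploitable.
v1 findings kept verbatim below: (§2) junk-`T` door closed for D1; (§4) D1 at `PUnit`; (§3) for D1 the load-bearing hypothesis is
`PlaneLimits.1` in degree 3 (modulo the landed phantom witness).

## Findings index
* §1 `D1`, `S6i` — the two stubs of the registered top composition, VERBATIM; `weakCouplingHypercubicLimitRP_of_D1_of_S6i`
  re-derives the crux from them via the LANDED composition `weakCouplingHypercubicLimitRP_of_diagRP_of_rpCoreDisjoint`
  (p825896) — certifies that the binder types attacked here are exactly the registered ones.
* §2 `planeSum_eq_of_planeLimits`, `diagonalFrameRP_congr_offDiagonal`, `diagonalFrameRP_planeSum_iff_of_planeLimits`: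
  for fixed `(G, r, sch, φ)` and two plane-limit families `T, T'`, `DiagonalFrameRP (planeSum T) ↔ DiagonalFrameRP (planeSum T')`.
  Reason: the E2 form in a diagonal frame evaluates the family only on `linActMulti R (θF̄ᵢ ⊗ Fⱼ)`, which is off-diagonal
  (`CurvatureChannel.isOffDiagonal_linActMulti_of_isAppendTensorOf`), where `PlaneLimits.1` pins `T`. ⇒ regime ρ2 (junk `T`,
  i.e. the values of `T` off `⁰𝒮`, unconstrained by `PlaneLimits`) CANNOT refute D1.
* §3 `weakScheme` (`a_k = 1/(k+1)`, `β_k = k → ∞`, `L_k = (k+1)²`, `c ≡ m ≡ 0`) with `hasWeakCouplingLimit_weakScheme`,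
  `polyVolume_weakScheme` (N = 1), `polyRenorm_weakScheme` (Q = 0), `uniformFunctionalBoundPlanes_weakScheme`,
  `rpSpectral_of_subsingleton` (Δ = 1, C = 0, any one-element `G`): ALL side hypotheses of D1 hold on this junk instance, so none
  of `HasWeakCouplingLimit / PolyVolume / PolyRenorm / UFB / RPSpectral / StrictMono φ` constrains the limit family by itself.
  `D1_false_without_degreeThreeConvergence : PhantomWitness → ¬ D1WithoutDegreeThreeConvergence` (D1 with `PlaneLimits.1`
  kept in all degrees `n ≠ 3`) and `D1_false_without_convergence`. `PhantomWitness` (a tempered family equal to the vacuum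
  family off degree 3 and failing 45°-frame RP) is INHABITED by the landed phantom family of `DiagonalMirrorRPR/Negative`
  (p72135, p72850); those modules are farm-`stale:unbuilt` today, so the witness is a hypothesis here (10-line discharge script
  in §3). MORAL for provers: any proof of D1 must use the lattice origin of `T₃` on `⁰𝒮`; cf. the tree refutations of the
  ABSTRACT strengthening "axis-RP + hypercubic invariance + temperedness + gap ⇒ diagonal RP" (`L1GaussianNotDiagonalRP`
  p73789, `SquareTorusNotSwapRP` p71699): the conclusion is not a consequence of the abstract OS-type package of `planeSum T`.
* §4 `diagonalFrameRP_planeSum_of_subsingleton`, `D1_at_punit`: for EVERY one-element gauge group, every `LatticeRep`,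
  scheme, `φ`, `T` with `PlaneLimits`, `DiagonalFrameRP (planeSum T)` HOLDS. Mechanism (`timeReflection_frame_lattice`,
  `latSum_linActMulti_appendTensor`): the reflection of a diagonal frame `R e₀ = a e₀ + b e₁` acts on the cubic lattice as the
  signed swap `(s₀,s₁,s₂,s₃) ↦ (τs₁, τs₀, s₂, s₃)`, `τ = −2ab ∈ {±1}`, so at a one-element group (deterministic plaquette weights)
  the lattice E2 form is the perfect square `conj(s_k)·s_k` at every step `k`, and the limit inherits `re ≥ 0, im = 0`.
  ⇒ the hypothesis `IsCompactSimpleLieGroup G`, present in S6i but ABSENT from D1, is not exploitable (regime ρ0a closed).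
* §5 (g2) `D1'` — the v2 registered stub `stub_oddTorusSwapPairingLiminf` VERBATIM; `D1_of_D1'` (= the skeleton's proof of
  `diagRPOfPlaneLimits_of_stubs` with the stub as a hypothesis, through the landed transfer p827255);
  `weakCouplingHypercubicLimitRP_of_D1'_of_S6i` — the crux by name from {D1′, S6i} (= the v2 registered stub set).
* §6 (g2) `rpSpectral_subseq`; `liminf_nonneg_of_eventually`, `liminf_nonneg_of_subseq` (real-sequence lemmas, junk-`liminf` aware);
  `D1''` (D1′ without `φ`, `T`, `PlaneLimits`: `… → OddTorusSwapPairingLiminf r sch`); `D1'_of_D1''` (hypotheses restrict to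
  `subseq sch φ hφ`; `T`, `PlaneLimits` unused); `D1''_of_D1'` (subsequence principle + landed Z2 `stub_planeLimits` on
  `subseq sch ψ hψ` + D1′ at the sub-scheme; `latticeSchwinger_subseq` is `rfl`); `D1'_iff_D1''`.
  CONSEQUENCES. (i) For door B / door C suppliers: the socket to fill is `OddTorusSwapPairingLiminf r sch` for an arbitrary
  admissible scheme — no `φ`, no `T`; a supplier stated for `subseq sch φ hφ` under `PlaneLimits` gains nothing from them.
  (ii) For disprovers: D1′ has NO continuum content to attack (no limit family, no frame, no rotation) — a counterexample is an
  admissible scheme with `pairing_{k_j} ≤ −ε` along a subsequence, i.e. a failure of finite-size/seam decoupling on the odd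
  torus under a uniform physical gap; see census v2.
* §7 (g2) `latticeSchwinger_of_subsingleton`, `latticeSchwinger_append_of_subsingleton` (factorisation of appended strings),
  `latticeSchwinger_mirror` (ANY `G`: the swap-mirrored string `σu j = u (rev j) ∘ swap₀₁` has the same `n`-point function —
  p827142's `latticeSchwinger_swap` + `Fin.revPerm` re-indexing), `oddTorusSwapPairingLiminf_of_subsingleton` (pairing at step
  `k` = `(Σᵢ cᵢ Xᵢ)²`), `D1''_at_subsingleton`, `D1'_at_subsingleton`: junk-`G` door closed for D1′ (regime ρ0a v2).
* §8 (g3) `gramPairing_eq_sq_of_subsingleton` (`gramPairing r sch F k = (famObs r sch F k V₀)²` at one-element `G`), `_nonneg_`, `_le_sq_`;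
  Kronecker-`tsum` bookkeeping; `eventually_three_le_side` (`3 ≤ side_k` eventually, any scheme); `vacuumSliceModel` (the rank-one
  `DiagonalSliceModel`: `sp k = δ₀`, `sm ≡ 0`, `top ≡ 1`, `wp F k = δ₀·gramPairing`, `wm ≡ 0`, `depth ≡ 1`), `oddTwistGap_vacuumSliceModel`
  (`μ = 1`), `diagLukewarm_vacuumSliceModel` (`θ = 1/4`, `C = 1`), `twistLetters_of_subsingleton` — DOOR-B LETTERS junk-closed.
* §9 (g3) `cubeLatticeSchwinger_eq_of_subsingleton`, `cubeGramPairing_eq_of_subsingleton`, `cubeDecoupling_of_subsingleton` (every `R`),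
  `admissibleCubeDecoupling_of_subsingleton` (`R = L`) — DOOR-C LETTER junk-closed.
* §10 (g3) `letters_jointly_satisfiable_at_punit` — binders + both letters + socket at once at `(PUnit, punitRep, weakScheme)`; both
  pipelines composed there through the LANDED bridges: `socket_via_doorB_at_punit` (p827816/p828264), `socket_via_doorC_at_punit` (p828702).
* §11 (g3) `S6iWithoutSimple` (S6i with `IsCompactSimpleLieGroup G →` dropped, otherwise verbatim), `S6i_of_S6iWithoutSimple`,
  `kappaThree_eq_zero_of_subsingleton`, `rpCoreDisjoint_false_without_simple : ¬ S6iWithoutSimple` (witness `PUnit`; S6i's own instance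
  at `PUnit` is vacuous, `punit_connected_not_simple`).

## REPAIR / REGIME CENSUS v3 (g3 additions; v2 below stays in force)
* ρ0a (v3) one-element `G` → not only D1″ (§7) but door B's `TwistLetters` (§8) and door C's `AdmissibleCubeDecoupling` (§9) are TRUE,
  jointly with all five binders (§10, Lean). For disprovers: every Lean-typed statement of the line below the crux (D1′, D1″, both letters,
  every bridge hypothesis) holds at the only computable gauge group; a kill needs a nonabelian model. For planners: no letter is
  vacuous-by-typing (each is inhabited together with the binders), and none is refutable for junk reasons.
* ρ7 door B is a RATE statement. By `core_of` (Theorems/DiagonalMirrorRPRSignTwistedCore) a model with R1/R2 yields `pairing_k ≥ −ε_k`,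
  `ε_k = O(K² a_k^{−2P} (a_k S_k)^{2Q} e^{−γ(1−2θ) a_k S_k})` — exponentially small in the physical torus size — whereas D1″ needs only
  `liminf ≥ 0`. In any `DiagonalSliceModel`, `pairing_eq` + `wp ≥ 0` make the even-sector part of the finite-`k` pairing non-negative, so
  ALL finite-`k` negativity of the torus swap pairing (the seam/glide term of census v2 (b), nonzero for nonabelian `G`, p71699 pattern)
  must be carried by the odd sector, where `weight_dom` + R1 bound it by `2‖Y_k(F)‖∞² e^{−γ a_k (S_k − 2 d_k)}`. So the letters say «the
  seam negativity is a U-odd effect with a physical gap γ» — the lead's `LocalDetectability` residual (PICKED.md r1), NOT typed in Lean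
  (it lives on the odd root of a nonabelian diagonal transfer operator; no such object is constructible in the tree today). A door-B-only
  kill = an admissible gapped scheme whose seam negativity → 0 slower than every `e^{−c a_k S_k}` (D1″ true, letters false); no
  candidate: under a gap the seam term is itself a connected correlation across ≳ `a_k L_k` physical units. At junk `G` the negativity
  is identically zero (§8), so the junk model cannot separate letters from socket. COROLLARY (cheap future kill): a door-B model landed
  with EMPTY odd sector (`sm ≡ 0`) for a nonabelian `G` certifies eventual finite-`k` swap positivity of all reflected families
  (`pairing_eq`, `wp ≥ 0`) — false by the seam ⇒ refutable as mis-stated. R2 thermodynamic sanity: for a gapped theory with unique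
  vacuum the normalised heat trace at aspect ≥ θ is `1 + O(V_k e^{−m θ a_k S_k}) → 1` (`PolyVolume`): plausible; `= 1` at junk `G` (§8).
* ρ6 flux / centre (toron) sectors of the periodic torus → HARMLESS to both doors: centre twists permute the flat sectors and fix every
  LOCAL gauge-invariant cylinder function (`YMSpecies = LocalGaugeObservable`), so torus expectations of curvature strings do not see
  the sector sum (door C's torus-vs-cube difference is a pure boundary effect at distance `≳ R_k` sites from the supports); in door B's
  slicing the near-degenerate toron states are `W`-invariant and `U`-EVEN with multiplicity `≤ |Z(G)|³`, bounded in R2 and absent from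
  R1. Finite abelian `G` at `β_k → ∞` (ρ0b): its flat sectors are likewise centre images of one another — no candidate (PAPER).
* S6i: `IsCompactSimpleLieGroup G` is LOAD-BEARING (§11, Lean) — mere non-triviality of `G` is what the `κ₃` floor needs; the other S6i
  conjuncts are junk-satisfiable (§10). No cheap attack on S6i proper (it is the open problem: weak-coupling uniform gap + UFB +
  non-Gaussianity for compact simple `G`); not a disprover target.
* Door C (`AdmissibleCubeDecoupling`, `R_k ≤ L_k`, `a_k R_k → ∞`) = exponential insensitivity of fixed compactly supported strings to
  the boundary condition (periodic torus vs free cube) under a uniform physical gap — the standard finite-size mechanism; exact equality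
  at junk `G` (§9); no gapped model violating it is known (PAPER). The prover's burden is to get it from `RPSpectral` AS TYPED
  (reflection clustering of time-slab functionals on tori `S ≥ L_k`), which controls separation along ONE axis at a time.
RE-TYPING (v3): none needed for D1′ or the letters. S6i: keep `IsCompactSimpleLieGroup G →` (load-bearing, §11).

## REPAIR / REGIME CENSUS v2 (target D1′ ⟺ D1″; g2; PAPER = prose only)
* ρ1 admissible SU(N)-type scheme → NO CANDIDATE, NO PROOF. By §6 the question is: does a uniform physical gap (`RPSpectral`,
  all tori `S ≥ L_k`, rate `Δ·a_k` per site) force the own-odd-torus swap Gram pairing of FIXED compactly supported mirrored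
  families to have `liminf ≥ 0`? Mechanism census: (a) BULK: Wilson's action on `ℤ⁴` (and on the free hypercube `Q_R`, door C's
  `CubeHalfRP`, Theorems/DiagonalMirrorRPRCubeSurgeryDefs :128) IS swap-RP — the swap is a site-type mirror with fixed hyperplane
  `v = x₀ − x₁ = 0`: `(0,1)`-plaquettes at the diagonal are Gram kernels `Re tr ρ(W₊ (θW₊)⁻¹)`, `(0,μ)/(1,μ)` plaquettes lie in one
  closed half, `(2,3)`-plaquettes and `e₂,e₃`-links on `v = 0` are the shared block, fixed POINTWISE by the swap; (b) SEAM: on the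
  odd torus `ℤ_S`, `S = 2L+1`, the swap `v ↦ −v` also exchanges the ADJACENT slices `v = L` and `v = L+1 ≡ −L` (a bond-type seam with
  no mirror): a site `x` with `v = L` is joined by its `e₀`-link to `y = x + e₀` with `v(y) ≡ −L`, and `y = W^{(S+1)/2} θx`
  (`W` = translation by `e₀+e₁`), NOT `θx` — a GLIDE, which is exactly door B's half-translation `A_k = K_k W_k^{−(S+1)/2}`; this
  is why finite-`k` swap-RP fails on straight tori (tree: `SquareTorusNotSwapRP` p71699) and why no finite-`k` instrument can
  kill D1′ (critic g12, O4 WORD 25 (1)); (c) DECOUPLING: the test functions are `k`-independent with compact support while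
  `a_k L_k → ∞` (scheme axiom `tendsto_L`), so the families sit `≳ a_k L_k` physical units from the seam; under `RPSpectral` the
  seam's influence on the pairing is `O(poly(a_k⁻¹)·e^{−Δ a_k L_k}) → 0` by `PolyVolume` + `PolyRenorm` (heuristic bound —
  this IS door C's letter `AdmissibleCubeDecoupling`, :157, and the content of door B's R1/R2), and the bulk term is ≥ 0 by (a).
  A counterexample therefore needs the decoupling to fail at an admissible, gapped scheme — no model in the tree or in print
  does that; it is NOT the rotation-restoration problem any more (v1 census), but the finite-size-under-gap problem. OPEN, with
  the universal expectation TRUE.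
* ρ0a one-element `G` → D1′ TRUE (§7, Lean). ρ0b finite `G`, `β_k → ∞` → PAPER: frozen regime, correlations of the curvature
  strings become ultralocal faster than `c_k` grows; families are eventually ≥ 2 sites from the seam ⇒ pairing = bulk value ≥ 0
  (product/frozen measure is swap-RP with pointwise-fixed shared block); no kill. ρ0c `β_k ≡ 0` (excluded only by
  `HasWeakCouplingLimit`) → product Haar measure, ultralocal: same conclusion, D1″-without-`HasWeakCouplingLimit` still TRUE
  there — so `HasWeakCouplingLimit` is NOT shown load-bearing by the cheap models (PAPER). ρ0d `G ⊇ U(1)` Coulomb phase → `RPSpectral`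
  fails (power-law decay) ⇒ D1″ vacuous there; whether the gap is load-bearing (massless bulk is still swap-RP in the limit, but
  seam terms decay only polynomially against `c_k ~ a_k^{−4}`) is undecidable without a model computation (PAPER, no claim).
* ρ2 junk `T` / ρ4 `φ` as a handle → IMPOSSIBLE for D1′: `T`, `φ`, `PlaneLimits` are decoration (§6, Lean).
* ρ3 ultralocal SU(N) schemes (`β_k → ∞` slowly against `a_k → 0`; admitted) → as ρ0b; no kill; NOTE for door B: R1/R2 must hold
  in this regime too (they are stated for every admissible scheme).
* ρ5 natural strengthenings: finite-`k` positivity `∀ k, 0 ≤ pairing_k` → FALSE in general by the seam (b) (p71699 pattern; at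
  one-element `G` it is true, §7, so no Lean certificate at a computable model here); dropping the support condition
  `tsupport f ⊆ {x₁ < x₀}` or the mirror convention `σf j = f (rev j) ∘ swap₀₁` → false already in the continuum (not RP-shaped);
  D1′ uses exactly the OS convention (order-reversing involution; real coefficients suffice since the Gram matrix is symmetric,
  p827142 `latticeSchwinger_append_mirror_symm`) — no mis-statement found.
* Door-B letters (`TwistLetters` = ∃ 𝔪 : DiagonalSliceModel, `OddTwistGap 𝔪 ∧ DiagLukewarm 𝔪`, p827648) — free-field sanity
  (PAPER): for a free massive lattice field in the diagonal slicing the odd root `A = K W^{−(S+1)/2}` has kernel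
  `exp(⟨φ′, Cφ⟩)`, `C = W^{(S+1)/2} + W^{−(S+1)/2}` with eigenvalue `2(−1)^j cos(πj/S)` on slice momentum `2πj/S`, so
  `U = sgn A = (−1)^{#quanta in odd slice momenta}`; every `U`-odd state contains a particle, whence `max sm/top ≤ e^{−(a/√2)·m}`:
  R1 holds with `γ = m/√2` GIVEN a mass gap, and R2 (bounded normalised heat trace at aspect ≥ θ) holds by thermal suppression.
  No cheap kill of R1/R2; both are gap statements for the diagonal slicing, consistent with the critic's REV-PASS.
RE-TYPING (v2): **D1′ needs no re-typing on account of this pass.** Optional free simplification (no change of strength, §6):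
replace D1′ by D1″ (drop `φ hφ T` and `PlaneLimits`), or keep D1′ and let suppliers target `OddTorusSwapPairingLiminf r sch`.
Optional free strengthening as in v1: add `IsCompactSimpleLieGroup G →` (S6i supplies it).

## REPAIR / REGIME CENSUS v1 (target D1; g0; kept for the record)
* ρ1 admissible SU(N)-type scheme, `β_k → ∞`, `RPSpectral` gap, anisotropic subsequential plane limit → NO CANDIDATE and NO
  PROOF: a witness must be a hypercubic-invariant, axis-RP, gapped limit of Wilson plaquette strings failing 45° RP; nothing in
  the tree or in print produces one (rotation restoration in the scaling region is the universal expectation — Lang–Rebbi,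
  Phys. Lett. 115B (1982) 137; Kogut–Sinclair–Pearson–Richardson–Shigemitsu 1981; Montvay–Münster §3.5 — numerical /
  perturbative, no theorem either way). D1 restricted to ρ1 is the O(4)-restoration problem for the curvature channel: OPEN.
* ρ0a `G = PUnit` → D1 TRUE there (§4, Lean).
* ρ0b finite `G`, `β_k → ∞` → PAPER: frozen/ultralocal regime, subsequential plane limits are constant-field/vacuum families,
  diagonal RP holds (pattern of `InfiniteCouplingSlice.constField_pullback_isReflectionPositive`); no kill expected.
* ρ0c `G` with a `U(1)` factor at weak coupling → PAPER: massless Coulomb phase violates `RPSpectral Δ > 0` eventually ⇒ D1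
  vacuously true there; no kill.
* ρ2 junk `T` (values off `⁰𝒮`) → IMPOSSIBLE (§2, Lean).
* ρ3 ultralocal SU(N) schemes (`β_k → ∞` arbitrarily slowly against `a_k → 0`: ADMITTED by D1, nothing ties `β_k` to `a_k`)
  → limits expected trivial/isotropic (constant-field-like), diagonal RP plausible; NOTE for door B: a proof of D1 may not
  assume the limit is a non-trivial field. No kill.
* ρ4 reducible `ρ`, counterterms `m_k`, `c_k`, subsequence `φ` as anisotropy handles → none (same `c_k`, `m_k/6` on all six
  planes; Wilson action `W(B₄)`-invariant; `φ` only selects).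
* ρ5 abstract strengthening (drop the lattice origin of `T`, keep axis-RP + invariance + temperedness + gap) → ALREADY REFUTED
  in tree (p73789, p71699); consistent with §3.
RE-TYPING: **D1 needs no re-typing on account of this pass** (no hypothesis broken). Free strengthening recommended (S6i
supplies it, so the composition is unchanged): add `IsCompactSimpleLieGroup G →` — and optionally S6i's κ₃-floor conjunct — to
D1's hypotheses, so that D1 quantifies over the regime the line actually produces; a future ρ1 repair, if ever needed, belongs in
an isotropy / scheme-selection conjunct exported by S6i (idea-crit-9 g12), never in abandoning FOLD F.
HONEST REGISTER: nothing in this file bears on the Yang–Mills mass gap; supporting or refuting a stub is bookkeeping for the line.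

## HANDOFF (cdisprove-27398-1 g3 → next disprover seat)
g3 filed: `Theorems/WeakCouplingHypercubicLimitRP/Negative/LettersJunkGroup.lean` (§8–§11 def-free: `twistLetters_of_subsingleton` with
the vacuum model built inline, `admissibleCubeDecoupling_of_subsingleton`, `letters_jointly_satisfiable_at_punit`,
`kappaThree_eq_zero_of_subsingleton`, `rpCoreDisjoint_false_without_simple` stated with the ∀-statement inline; p-id in the seat's STATUS
line). Sorried here: nothing. Still blocked: the phantom discharge of §3 (farm `stale:unbuilt` for
`…DiagonalMirrorRPR.Negative.HconvLoadBearing`, re-checked 2026-08-31). Next seat: (i) the only live target is the U-odd / seam residual of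
census v3 ρ7 (= the lead's `LocalDetectability`); it becomes attackable in Lean only when a nonabelian `DiagonalSliceModel` (hand
`wilsonDiagonalModel`) or any finite-`k` transfer-operator object lands — then test R1 `OddTwistGap` against the glide/seam term of
p71699's square-torus witness transported to the odd torus; (ii) if a door-B model lands with `sm ≡ 0` (empty odd sector) for a
nonabelian `G`, it is refutable at once (ρ7 corollary) — file as `stub-misstated`; (iii) door C: a model computation of the
torus-minus-cube pairing for `G = ℤ₂` in the confined (gapped, non-deterministic) phase would be the first non-junk sanity check of
`CubeDecoupling` — `kit` only, not this seat's allowance.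

## HANDOFF v2 (cdisprove-27398-1 g2 → g3; g3 did item (iii): letters instantiated at `Subsingleton G` / `weakScheme` — all TRUE, §8–§10)
g2 filed: `Theorems/WeakCouplingHypercubicLimitRP/Negative/OddTorusSwapPairingLiminf.lean` (§6–§7 in def-free form: the
decoration equivalence stated with both ∀-statements inline, `rpSpectral_subseq`, the `liminf` lemmas, the subsingleton square;
p-id in the seat's STATUS line). Sorried here: nothing. Next: (i) v1 item (i) below (phantom discharge) still blocked on the farm
build of `…DiagonalMirrorRPR.Negative.HconvLoadBearing` (rc 75 `stale:unbuilt` on 2026-08-31); (ii) the only live disproof target is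
ρ1-decoupling (census v2 (c)): look for an admissible gapped scheme whose seam term does not die — equivalently attack door C's
`AdmissibleCubeDecoupling` / door B's R1 at a NON-trivial but tractable `G` (finite abelian `G` at `β_k → ∞` is frozen, ρ0b; the
first honest candidate would need a genuinely interacting model with a provable gap — none tractable in Lean today); (iii) when
hand-3 lands `wilsonDiagonalModel`, instantiate R1/R2 at `Subsingleton G` and at the `weakScheme` of §3 to test the letters for
vacuity-by-typing (one-element `G`: is `OddTwistGap` true with every `γ`? if it FAILS there while D1″ holds (§7), R1 is stronger
than needed on that instance — report as `stub-misstated` evidence, not a kill).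

## HANDOFF v1 (cdisprove-27398-1 g0 → g2; done items struck by g2: target re-pointed to D1′ ✓, junk doors for D1′ ✓)
Filed through the gate by this seat (verdicts pending at exit, review-queued because they carry defs): p827697
`Theorems/WeakCouplingHypercubicLimitRP/Negative/DiagRPOfPlaneLimits.lean` (§2 + §3 in existential form, no Prop defs) and
p827699 `Theorems/WeakCouplingHypercubicLimitRP/Negative/DiagRPOfPlaneLimitsJunkGroup.lean` (§4). Sorried here: nothing. Next: (i) discharge `PhantomWitness` by `import
…DiagonalMirrorRPR.Negative.HconvLoadBearing` once the farm builds it (script after `D1_false_without_convergence`);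
(ii) ρ1 proper: decide whether an `L1GaussianNotDiagonalRP`-type family can be a `PlaneLimits` limit of `planeDist` for a
non-trivial compact `G` (for one-element `G` it cannot, §4) — this is the rotation-restoration question, attack it through
the degree-2 plane covariance (Källén–Lehmann/Bochner shape of a W(B₄)-invariant RP two-point function vs O(4));
(iii) if the lead opens door B, attack the stubs that use non-triviality of the limit (ρ3).
-/

noncomputable section

open scoped SchwartzMap ComplexConjugate InnerProductSpace
open MeasureTheory Filter Topology Complex
open Literature.MathematicalPhysics.AQFT Literature.MathematicalPhysics.QuantumLattice
open Literature.MathematicalPhysics.QuantumFieldTheory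
open Literature.Probability.LatticeModels (box Site mem_box)
open Summit.QuantumFields.YangMills.Cruxes.HypercubicLimit.CouplingResponse
open Summit.QuantumFields.YangMills.Cruxes.DiagonalMirrorRPR.ParityBridgeColdTraces (DiagonalFrameRP E4)
open Summit.QuantumFields.YangMills.Cruxes.DiagonalMirrorRPR.ParityBridgeColdTraces.RpClosure (swap01 latticeSchwinger_swap
  latticeSchwinger_comp_equiv)
open Summit.QuantumFields.YangMills.Cruxes.DiagonalMirrorRPR.SignTwistedDiagonalTrace (OddTorusSwapPairingLiminf
  uniformFunctionalBoundPlanes_subseq)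
open Summit.QuantumFields.YangMills.Theorems.OSLegsFromFemtoAndGap (latticeDistStr torusMomentStr
  latticeDistStr_apply)
open Summit.QuantumFields.YangMills.Theorems.HypercubicLimit.Negative (punitRep)
open Summit.QuantumFields.YangMills.Theorems.CurvatureChannel (isOffDiagonal_linActMulti_of_isAppendTensorOf)

namespace Summit.QuantumFields.YangMills.Cruxes.WeakCouplingHypercubicLimitRP.Disproof

/-! ## §1 The target D1 = `stub_diagRPOfPlaneLimits`, verbatim, and its place in the composition -/

/-- **D1** (`stub_diagRPOfPlaneLimits`, `Lines/Sketch.lean` l.1618–1625, VERBATIM): along any subsequence `φ`, the summed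
plane-string limit family `planeSum T` of an admissible weak-coupling scheme is reflection positive in every diagonal frame. -/
def D1 : Prop :=
  ∀ (G : Type) [Group G] [TopologicalSpace G] [IsTopologicalGroup G] [CompactSpace G]
    [MeasurableSpace G] [BorelSpace G] (r : LatticeRep G) (sch : SpeciesScheme (YMSpecies G))
    (φ : ℕ → ℕ) (hφ : StrictMono φ)
    (T : (n : ℕ) → (Fin n → Plane) → (𝓢((Fin n → EuclideanSpace ℝ (Fin 4)), ℂ) →L[ℂ] ℂ)),
    sch.HasWeakCouplingLimit → PolyVolume sch → PolyRenorm r sch → UniformFunctionalBoundPlanes r sch →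
      (∃ Δ C : ℝ, 0 < Δ ∧ RPSpectral r sch Δ C) → PlaneLimits r sch φ T → DiagonalFrameRP (planeSum T)

/-- **S6i** (`stub_rpCoreDisjoint`, the heart, VERBATIM as the second hypothesis of the registered composition). -/
def S6i : Prop :=
  ∀ (G : Type) [Group G] [TopologicalSpace G] [IsTopologicalGroup G] [CompactSpace G]
    [MeasurableSpace G] [BorelSpace G], IsCompactSimpleLieGroup G →
    ∃ (r : LatticeRep G) (sch : SpeciesScheme (YMSpecies G)),
      sch.HasWeakCouplingLimit ∧ PolyVolume sch ∧ PolyRenorm r sch ∧ UniformFunctionalBoundPlanes r sch ∧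
      (∃ Δ C : ℝ, 0 < Δ ∧ RPSpectral r sch Δ C) ∧
      (∃ (f g h : 𝓢(EuclideanSpace ℝ (Fin 4), ℝ)) (δ : ℝ),
        Disjoint (tsupport f) (tsupport g) ∧ Disjoint (tsupport f) (tsupport h) ∧
        Disjoint (tsupport g) (tsupport h) ∧ 0 < δ ∧
        ∀ᶠ k in atTop, δ ≤
          |latticeSchwinger r.ρ sch (fun s => s.F) k 3 (fun _ => r.curvature) ![f, g, h] -
            latticeSchwinger r.ρ sch (fun s => s.F) k 1 (fun _ => r.curvature) ![f] *
              latticeSchwinger r.ρ sch (fun s => s.F) k 2 (fun _ => r.curvature) ![g, h] -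
            latticeSchwinger r.ρ sch (fun s => s.F) k 1 (fun _ => r.curvature) ![g] *
              latticeSchwinger r.ρ sch (fun s => s.F) k 2 (fun _ => r.curvature) ![f, h] -
            latticeSchwinger r.ρ sch (fun s => s.F) k 1 (fun _ => r.curvature) ![h] *
              latticeSchwinger r.ρ sch (fun s => s.F) k 2 (fun _ => r.curvature) ![f, g] +
            2 * (latticeSchwinger r.ρ sch (fun s => s.F) k 1 (fun _ => r.curvature) ![f] *
              latticeSchwinger r.ρ sch (fun s => s.F) k 1 (fun _ => r.curvature) ![g] *
              latticeSchwinger r.ρ sch (fun s => s.F) k 1 (fun _ => r.curvature) ![h])|)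

/-- Certificate that `D1` and `S6i` ARE the two binder types of the registered top composition
`weakCouplingHypercubicLimitRP_of_diagRP_of_rpCoreDisjoint` (landed, p825896): the crux by name from D1 and S6i. [folklore] -/
theorem weakCouplingHypercubicLimitRP_of_D1_of_S6i (hD1 : D1) (hcore : S6i) :
    Summit.QuantumFields.YangMills.Theses.PencilRigidity.WeakCouplingHypercubicLimitRP :=
  Summit.QuantumFields.YangMills.Theorems.WeakCouplingHypercubicLimit.TraceNormColdPressure.weakCouplingHypercubicLimitRP_of_diagRP_of_rpCoreDisjoint
    hD1 hcore

/-! ## §2 Junk audit: D1's truth value does not depend on `T` (only on `(G, r, sch, φ)`) -/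

section TIndependence

variable {G : Type} [Group G] [TopologicalSpace G] [IsTopologicalGroup G] [CompactSpace G]
  [MeasurableSpace G] [BorelSpace G]

/-- Two `PlaneLimits` packages of the same `(r, sch, φ)` have the same summed family on `⁰𝒮`. [folklore] -/
theorem planeSum_eq_of_planeLimits {r : LatticeRep G} {sch : SpeciesScheme (YMSpecies G)} {φ : ℕ → ℕ}
    {T T' : (n : ℕ) → (Fin n → Plane) → (𝓢((Fin n → EuclideanSpace ℝ (Fin 4)), ℂ) →L[ℂ] ℂ)}
    (hT : PlaneLimits r sch φ T) (hT' : PlaneLimits r sch φ T') {n : ℕ}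
    {F : 𝓢((Fin n → EuclideanSpace ℝ (Fin 4)), ℂ)} (hF : IsOffDiagonal F) :
    planeSum T n F = planeSum T' n F :=
  tendsto_nhds_unique (hT.tendsto_planeSum F hF) (hT'.tendsto_planeSum F hF)

omit [Group G] [TopologicalSpace G] [IsTopologicalGroup G] [CompactSpace G] [MeasurableSpace G]
  [BorelSpace G] in
/-- `DiagonalFrameRP` only reads a family on `⁰𝒮`: the E2 witnesses `θFᵢ* ⊗ Fⱼ` are off-diagonal and every pull-back
`linActMulti R` preserves `⁰𝒮` (`CurvatureChannel.isOffDiagonal_linActMulti_of_isAppendTensorOf`). [folklore] -/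
theorem diagonalFrameRP_congr_offDiagonal {S S' : SchwingerFamily (EuclideanSpace ℝ (Fin 4))}
    (h : ∀ (n : ℕ) (F : 𝓢((Fin n → EuclideanSpace ℝ (Fin 4)), ℂ)), IsOffDiagonal F → S n F = S' n F)
    (hS : DiagonalFrameRP S) : DiagonalFrameRP S' := by
  intro R a b ha hb hR N deg lab F hF H hH
  have hz := hS R a b ha hb hR N deg lab F hF H hH
  have hterm : ∀ i j,
      (SchwingerFamily.toLabelled (fun n => (S' n).comp (linActMulti R))) (deg i + deg j)
          (Fin.append (lab i ∘ Fin.rev) (lab j)) (H i j) =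
        (SchwingerFamily.toLabelled (fun n => (S n).comp (linActMulti R))) (deg i + deg j)
          (Fin.append (lab i ∘ Fin.rev) (lab j)) (H i j) := by
    intro i j
    rw [SchwingerFamily.toLabelled_apply, SchwingerFamily.toLabelled_apply, ContinuousLinearMap.comp_apply,
      ContinuousLinearMap.comp_apply]
    exact (h _ _ (isOffDiagonal_linActMulti_of_isAppendTensorOf R (hF i) (hF j) (hH i j))).symm
  simp only [hterm]
  exact hz

/-- **T-independence of D1.** For fixed `(r, sch, φ)` the conclusion `DiagonalFrameRP (planeSum T)` has the same truth
value for every `T` with `PlaneLimits r sch φ T`: no junk-`T` refutation of D1 exists (values of `T` off `⁰𝒮`, which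
`PlaneLimits` leaves free, are never read by E2 in a diagonal frame). [folklore] -/
theorem diagonalFrameRP_planeSum_iff_of_planeLimits {r : LatticeRep G} {sch : SpeciesScheme (YMSpecies G)}
    {φ : ℕ → ℕ} {T T' : (n : ℕ) → (Fin n → Plane) → (𝓢((Fin n → EuclideanSpace ℝ (Fin 4)), ℂ) →L[ℂ] ℂ)}
    (hT : PlaneLimits r sch φ T) (hT' : PlaneLimits r sch φ T') :
    DiagonalFrameRP (planeSum T) ↔ DiagonalFrameRP (planeSum T') :=
  ⟨diagonalFrameRP_congr_offDiagonal fun _ _ hF => planeSum_eq_of_planeLimits hT hT' hF,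
    diagonalFrameRP_congr_offDiagonal fun _ _ hF => planeSum_eq_of_planeLimits hT' hT hF⟩

end TIndependence

/-! ## §3 Load-bearing analysis: the convergence clause `PlaneLimits.1` IN DEGREE 3 is load-bearing -/

section LoadBearing

variable {G : Type} [Group G] [TopologicalSpace G] [IsTopologicalGroup G] [CompactSpace G]
  [MeasurableSpace G] [BorelSpace G]

/-- In arity `0` every plane-string distribution is evaluation (the weight is `∫ 1 dμ = 1` and `(box L)⁰` is a point),
for EVERY gauge group and scheme. [folklore] -/
theorem planeDist_arity_zero (r : LatticeRep G) (sch : SpeciesScheme (YMSpecies G)) (k : ℕ) (q : Fin 0 → Plane)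
    (F : 𝓢((Fin 0 → EuclideanSpace ℝ (Fin 4)), ℂ)) : planeDist r sch k 0 q F = F 0 := by
  haveI := isProbabilityMeasure_wilsonMeasure (d := 4) (L := 2 * sch.L k + 1) r.ρ r.continuous (sch.β k)
  have hW : ∀ x : Fin 0 → Site 4, torusMomentStr r.ρ (sch.β k) (sch.L k) (fun i => (planeSpecies r (q i)).F)
      (fun _ => sch.m r.curvature k / 6) x = 1 := fun x => by
    unfold torusMomentStr
    simp only [Finset.univ_eq_empty, Finset.prod_empty, integral_const, smul_eq_mul, probReal_univ, one_mul]
  simp only [planeDist, latticeDistStr_apply, pow_zero, Complex.ofReal_one, one_smul, Fintype.piFinset_of_isEmpty,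
    Finset.univ_unique, Finset.sum_singleton, hW, one_mul]
  exact congrArg F (Subsingleton.elim _ _)

/-- With the curvature renormalisation silenced (`c_k = 0`) every plane-string distribution of positive arity vanishes. [folklore] -/
theorem planeDist_succ_eq_zero_of_c_eq_zero (r : LatticeRep G) (sch : SpeciesScheme (YMSpecies G)) {k : ℕ}
    (hc : sch.c r.curvature k = 0) (n : ℕ) (q : Fin (n + 1) → Plane)
    (F : 𝓢((Fin (n + 1) → EuclideanSpace ℝ (Fin 4)), ℂ)) : planeDist r sch k (n + 1) q F = 0 := by
  simp only [planeDist, _root_.smul_apply, smul_eq_mul, hc, zero_mul, zero_pow (Nat.succ_ne_zero n),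
    Complex.ofReal_zero]

/-- The **weakly silenced scheme**: the zero scheme (`a_k = 1/(k+1)`, `L_k = (k+1)²`, `c = m = 0`) with `β_k = k → ∞`. [folklore] -/
def weakScheme (ι : Type) : SpeciesScheme ι :=
  { SpeciesScheme.zero ι with β := fun k => (k : ℝ) }

omit [Group G] [TopologicalSpace G] [IsTopologicalGroup G] [CompactSpace G] [MeasurableSpace G] [BorelSpace G] in
/-- `β_k = k → ∞`. [folklore] -/
theorem hasWeakCouplingLimit_weakScheme (ι : Type) : (weakScheme ι).HasWeakCouplingLimit :=
  tendsto_natCast_atTop_atTop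

omit [Group G] [TopologicalSpace G] [IsTopologicalGroup G] [CompactSpace G] [MeasurableSpace G] [BorelSpace G] in
/-- `a_k⁻¹ = k + 1 = a_k L_k`: `PolyVolume` with `N = 1`. [folklore] -/
theorem polyVolume_weakScheme (ι : Type) : PolyVolume (weakScheme ι) := by
  refine ⟨1, le_rfl, Filter.Eventually.of_forall fun k => ?_⟩
  show (((k : ℝ) + 1)⁻¹)⁻¹ ≤ (((k : ℝ) + 1)⁻¹ * (((k + 1) ^ 2 : ℕ) : ℝ)) ^ 1
  rw [inv_inv, pow_one]
  push_cast
  have hk : (0 : ℝ) < (k : ℝ) + 1 := by positivity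
  rw [sq, ← mul_assoc, inv_mul_cancel₀ hk.ne', one_mul]

/-- `c = 0`: `PolyRenorm` with `Q = 0`. [folklore] -/
theorem polyRenorm_weakScheme (r : LatticeRep G) : PolyRenorm r (weakScheme (YMSpecies G)) :=
  ⟨0, fun k => by simp [weakScheme, SpeciesScheme.zero]⟩

/-- UFB for the weakly silenced scheme (every `G`): arity `0` is evaluation, positive arities vanish. [folklore] -/
theorem uniformFunctionalBoundPlanes_weakScheme (r : LatticeRep G) :
    UniformFunctionalBoundPlanes r (weakScheme (YMSpecies G)) := by
  refine ⟨0, 1, 0, fun n q F _ k => ?_⟩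
  rw [Real.rpow_zero, mul_one, one_mul, Nat.mul_zero]
  cases n with
  | zero =>
    rw [planeDist_arity_zero]
    exact norm_le_schwartzNorm 0 F 0
  | succ n =>
    rw [planeDist_succ_eq_zero_of_c_eq_zero r _ (by rfl) n q F, norm_zero]
    exact schwartzNorm_nonneg _ _

/-- For the trivial gauge group every configuration functional is constant, so `RPSpectral` holds at every rate with
thermal constant `0` (both sides of the clustering inequality vanish). [folklore] -/
theorem rpSpectral_of_subsingleton [Subsingleton G] (r : LatticeRep G) (sch : SpeciesScheme (YMSpecies G)) (Δ : ℝ) :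
    RPSpectral r sch Δ 0 := by
  refine Filter.Eventually.of_forall fun k S T n _ _ Y B _ _ _ => ?_
  haveI := isProbabilityMeasure_wilsonMeasure (d := 4) (L := 2 * S + 1) r.ρ r.continuous (sch.β k)
  obtain ⟨y, rfl⟩ : ∃ y : ℝ, Y = fun _ => y :=
    ⟨Y (fun _ => 1), funext fun V => congrArg Y (Subsingleton.elim _ _)⟩
  simp only [integral_const, smul_eq_mul, probReal_univ, one_mul]
  have h0 : y * y - y ^ 2 = 0 := by ring
  rw [h0, abs_zero, mul_zero, zero_mul, zero_mul, add_zero]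

/-- A reference plane (the `01`-plane). [folklore] -/
def plane₀ : Plane := ⟨((0 : Fin 4), (1 : Fin 4)), by decide⟩

/-- **Phantom witness** (abstract form of the landed phantom family of `DiagonalMirrorRPR/Negative`): a tempered family
`Φ` on `ℝ⁴` which is the vacuum family in every degree except `3` (`Φ₀ F = F 0`, `Φₙ = 0` for `n ∉ {0, 3}`), obeys ONE
uniform Schwartz-norm bound, and FAILS reflection positivity in some diagonal frame.
INHABITED by `Phantom.phantomFamily`: the accepted tree theorems
`DiagonalMirrorRPR.Negative.Phantom.exists_diagonalFrame_not_isReflectionPositive_phantomFamily` (`HconvLoadBearing.lean`, p72850),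
`Phantom.phantomFamily_apply`, `Phantom.phantom_of_ne_three`, `Phantom.vacuumFamily_apply` (`PhantomFamily.lean`, p72135) and
`SchwingerFamily.exists_bound_holds` give it in ten lines (script in the comment after `D1_false_without_convergence`).
Those two modules are `stale:unbuilt` on the Lean farm at this tree revision (2026-08-31T16Z, three retries), so they are
NOT imported and the witness is carried as the hypothesis of the two `_false_without_` theorems below. [folklore] -/
def PhantomWitness : Prop :=
  ∃ Φ : (n : ℕ) → (𝓢((Fin n → EuclideanSpace ℝ (Fin 4)), ℂ) →L[ℂ] ℂ),
    (∀ F : 𝓢((Fin 0 → EuclideanSpace ℝ (Fin 4)), ℂ), Φ 0 F = F 0) ∧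
    (∀ n : ℕ, n ≠ 0 → n ≠ 3 → Φ n = 0) ∧
    (∃ (s : ℕ) (α : ℝ), 0 ≤ α ∧
      ∀ (n : ℕ) (F : 𝓢((Fin n → EuclideanSpace ℝ (Fin 4)), ℂ)), ‖Φ n F‖ ≤ α * schwartzNorm (n * s) F) ∧
    ¬ DiagonalFrameRP Φ

variable (Φ : (n : ℕ) → (𝓢((Fin n → EuclideanSpace ℝ (Fin 4)), ℂ) →L[ℂ] ℂ))

/-- The **phantom plane family** of `Φ`: `Φ` placed on the constant `01`-string, zero on every other string, so that
`planeSum (phantomT Φ) = Φ`. [folklore] -/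
def phantomT : (n : ℕ) → (Fin n → Plane) → (𝓢((Fin n → EuclideanSpace ℝ (Fin 4)), ℂ) →L[ℂ] ℂ) :=
  fun n q => if q = fun _ => plane₀ then Φ n else 0

omit [Group G] [TopologicalSpace G] [IsTopologicalGroup G] [CompactSpace G] [MeasurableSpace G] [BorelSpace G] in
/-- `planeSum (phantomT Φ) = Φ`. [folklore] -/
theorem planeSum_phantomT : planeSum (phantomT Φ) = Φ := by
  funext n
  simp [planeSum, phantomT, Finset.sum_ite_eq']

omit [Group G] [TopologicalSpace G] [IsTopologicalGroup G] [CompactSpace G] [MeasurableSpace G] [BorelSpace G] in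
/-- The phantom plane family inherits the growth clause `PlaneLimits.2` (with `β = 0`). [folklore] -/
theorem phantomT_bound {s : ℕ} {α : ℝ} (hα : 0 ≤ α)
    (h : ∀ (n : ℕ) (F : 𝓢((Fin n → EuclideanSpace ℝ (Fin 4)), ℂ)), ‖Φ n F‖ ≤ α * schwartzNorm (n * s) F) :
    ∃ (s : ℕ) (α β : ℝ), ∀ (n : ℕ) (q : Fin n → Plane) (F : 𝓢((Fin n → EuclideanSpace ℝ (Fin 4)), ℂ)),
      ‖phantomT Φ n q F‖ ≤ α * (n.factorial : ℝ) ^ β * schwartzNorm (n * s) F := by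
  refine ⟨s, α, 0, fun n q F => ?_⟩
  rw [Real.rpow_zero, mul_one]
  unfold phantomT
  split_ifs
  · exact h n F
  · rw [_root_.zero_apply, norm_zero]
    exact mul_nonneg hα (schwartzNorm_nonneg _ _)

omit Φ in
/-- Over the weakly silenced scheme of the trivial gauge group, a family that is the vacuum family in degree `n`
(`n = 0`: evaluation; `n ≥ 1`: zero) IS the plane limit in degree `n`, along every `φ`. [folklore] -/
theorem tendsto_planeDist_phantomT [MeasurableSpace PUnit] [BorelSpace PUnit]
    {Φ : (n : ℕ) → (𝓢((Fin n → EuclideanSpace ℝ (Fin 4)), ℂ) →L[ℂ] ℂ)}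
    (h0 : ∀ F : 𝓢((Fin 0 → EuclideanSpace ℝ (Fin 4)), ℂ), Φ 0 F = F 0) (hvac : ∀ n : ℕ, n ≠ 0 → n ≠ 3 → Φ n = 0)
    {φ : ℕ → ℕ} {n : ℕ} (hn : n ≠ 3) (q : Fin n → Plane) (F : 𝓢((Fin n → EuclideanSpace ℝ (Fin 4)), ℂ)) :
    Tendsto (fun k => planeDist punitRep (weakScheme (YMSpecies PUnit)) (φ k) n q F) atTop (𝓝 (phantomT Φ n q F)) := by
  cases n with
  | zero =>
    have hq : q = fun _ => plane₀ := Subsingleton.elim _ _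
    have hT : phantomT Φ 0 q F = F 0 := by rw [phantomT, if_pos hq, h0]
    simp only [planeDist_arity_zero, hT]
    exact tendsto_const_nhds
  | succ n =>
    have hT : phantomT Φ (n + 1) q F = 0 := by
      unfold phantomT
      split_ifs
      · rw [hvac (n + 1) (Nat.succ_ne_zero n) hn, _root_.zero_apply]
      · rfl
    simp only [planeDist_succ_eq_zero_of_c_eq_zero punitRep (weakScheme (YMSpecies PUnit)) rfl, hT]
    exact tendsto_const_nhds

/-- **D1 with the degree-3 convergence deleted**: `PlaneLimits r sch φ T` is replaced by convergence on `⁰𝒮` in all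
degrees `n ≠ 3` plus the growth clause (everything else verbatim). -/
def D1WithoutDegreeThreeConvergence : Prop :=
  ∀ (G : Type) [Group G] [TopologicalSpace G] [IsTopologicalGroup G] [CompactSpace G]
    [MeasurableSpace G] [BorelSpace G] (r : LatticeRep G) (sch : SpeciesScheme (YMSpecies G))
    (φ : ℕ → ℕ) (hφ : StrictMono φ)
    (T : (n : ℕ) → (Fin n → Plane) → (𝓢((Fin n → EuclideanSpace ℝ (Fin 4)), ℂ) →L[ℂ] ℂ)),
    sch.HasWeakCouplingLimit → PolyVolume sch → PolyRenorm r sch → UniformFunctionalBoundPlanes r sch →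
      (∃ Δ C : ℝ, 0 < Δ ∧ RPSpectral r sch Δ C) →
      ((∀ (n : ℕ) (q : Fin n → Plane) (F : 𝓢((Fin n → EuclideanSpace ℝ (Fin 4)), ℂ)), n ≠ 3 → IsOffDiagonal F →
          Tendsto (fun k => planeDist r sch (φ k) n q F) atTop (𝓝 (T n q F))) ∧
        (∃ (s : ℕ) (α β : ℝ), ∀ (n : ℕ) (q : Fin n → Plane) (F : 𝓢((Fin n → EuclideanSpace ℝ (Fin 4)), ℂ)),
          ‖T n q F‖ ≤ α * (n.factorial : ℝ) ^ β * schwartzNorm (n * s) F)) →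
      DiagonalFrameRP (planeSum T)

/-- **D1 with the whole convergence clause deleted** (`PlaneLimits` replaced by its growth clause `PlaneLimits.2`). -/
def D1WithoutConvergence : Prop :=
  ∀ (G : Type) [Group G] [TopologicalSpace G] [IsTopologicalGroup G] [CompactSpace G]
    [MeasurableSpace G] [BorelSpace G] (r : LatticeRep G) (sch : SpeciesScheme (YMSpecies G))
    (φ : ℕ → ℕ) (hφ : StrictMono φ)
    (T : (n : ℕ) → (Fin n → Plane) → (𝓢((Fin n → EuclideanSpace ℝ (Fin 4)), ℂ) →L[ℂ] ℂ)),
    sch.HasWeakCouplingLimit → PolyVolume sch → PolyRenorm r sch → UniformFunctionalBoundPlanes r sch →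
      (∃ Δ C : ℝ, 0 < Δ ∧ RPSpectral r sch Δ C) →
      (∃ (s : ℕ) (α β : ℝ), ∀ (n : ℕ) (q : Fin n → Plane) (F : 𝓢((Fin n → EuclideanSpace ℝ (Fin 4)), ℂ)),
          ‖T n q F‖ ≤ α * (n.factorial : ℝ) ^ β * schwartzNorm (n * s) F) →
      DiagonalFrameRP (planeSum T)

/-- **Any proof of D1 must use the convergence clause in degree 3** (modulo the phantom witness, see `PhantomWitness`).
Instance: `G = PUnit`, `punitRep`, the weakly silenced scheme (weak coupling `β_k = k`, `PolyVolume` with `N = 1`, `PolyRenorm`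
with `Q = 0`, UFB, `RPSpectral` at rate `1` with thermal constant `0`), `φ = id`, and the phantom plane family `phantomT Φ`:
it is the plane limit in every degree `≠ 3`, obeys the growth clause, and `planeSum (phantomT Φ) = Φ` is not diagonal-frame
reflection positive. [folklore] -/
theorem D1_false_without_degreeThreeConvergence (hΦ : PhantomWitness) : ¬ D1WithoutDegreeThreeConvergence := by
  intro h
  letI : MeasurableSpace PUnit := borel PUnit
  haveI : BorelSpace PUnit := ⟨rfl⟩
  obtain ⟨Φ, h0, hvac, ⟨s, α, hα, hbd⟩, hnot⟩ := hΦ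
  have hD := h PUnit punitRep (weakScheme (YMSpecies PUnit)) id strictMono_id (phantomT Φ)
    (hasWeakCouplingLimit_weakScheme _) (polyVolume_weakScheme _) (polyRenorm_weakScheme punitRep)
    (uniformFunctionalBoundPlanes_weakScheme punitRep) ⟨1, 0, one_pos, rpSpectral_of_subsingleton punitRep _ 1⟩
    ⟨fun n q F hn _ => tendsto_planeDist_phantomT h0 hvac hn q F, phantomT_bound Φ hα hbd⟩
  rw [planeSum_phantomT] at hD
  exact hnot hD

/-- **A fortiori: D1 with the convergence clause deleted is false** (modulo the phantom witness). [folklore] -/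
theorem D1_false_without_convergence (hΦ : PhantomWitness) : ¬ D1WithoutConvergence := fun h =>
  D1_false_without_degreeThreeConvergence hΦ fun G _ _ _ _ _ _ r sch φ hφ T hw hpv hpr hufb hrp hT =>
    h G r sch φ hφ T hw hpv hpr hufb hrp hT.2

/- DISCHARGE SCRIPT for `PhantomWitness` (not compiled here — needs
`import Summits.QuantumFields.YangMills.Theorems.DiagonalMirrorRPR.Negative.HconvLoadBearing`, farm `stale:unbuilt` today):

open Summit.QuantumFields.YangMills.Theorems.DiagonalMirrorRPR.Negative in
theorem phantomWitness_of_phantomFamily : PhantomWitness := by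
  obtain ⟨s₃, C₃, h₃⟩ := SchwingerFamily.exists_bound_holds Phantom.phantomFamily 3
  obtain ⟨R, a, b, ha, hb, hR, hnot⟩ := Phantom.exists_diagonalFrame_not_isReflectionPositive_phantomFamily
  refine ⟨Phantom.phantomFamily, fun F => ?_, fun n hn0 hn3 => ?_, ⟨s₃ + 1, max C₃ 0 + 1, by positivity, fun n F => ?_⟩,
    fun hRP => hnot (hRP R a b ha hb hR)⟩
  · rw [Phantom.phantomFamily_apply, Phantom.phantom_of_ne_three (by decide), Phantom.vacuumFamily_apply, if_pos rfl]; simp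
  · ext F; rw [Phantom.phantomFamily_apply, Phantom.phantom_of_ne_three hn3, Phantom.vacuumFamily_apply, if_neg hn0]; simp
  · have hα : 0 ≤ max C₃ 0 + 1 := by positivity
    by_cases hn3 : n = 3
    · subst hn3
      calc ‖Phantom.phantomFamily 3 F‖ ≤ C₃ * schwartzNorm s₃ F := h₃ F
        _ ≤ (max C₃ 0 + 1) * schwartzNorm s₃ F :=
            mul_le_mul_of_nonneg_right (by linarith [le_max_left C₃ 0]) (schwartzNorm_nonneg _ _)
        _ ≤ (max C₃ 0 + 1) * schwartzNorm (3 * (s₃ + 1)) F := mul_le_mul_of_nonneg_left (schwartzNorm_mono (by omega) F) hα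
    · rw [Phantom.phantomFamily_apply, Phantom.phantom_of_ne_three hn3, Phantom.vacuumFamily_apply]
      split_ifs with hn0
      · subst hn0
        simp only [ContinuousLinearMap.zero_apply, add_zero]
        calc ‖F 0‖ ≤ schwartzNorm (0 * (s₃ + 1)) F := norm_le_schwartzNorm _ F 0
          _ ≤ (max C₃ 0 + 1) * schwartzNorm (0 * (s₃ + 1)) F :=
              le_mul_of_one_le_left (schwartzNorm_nonneg _ _) (by linarith [le_max_right C₃ 0])
      · simp only [ContinuousLinearMap.zero_apply, add_zero, norm_zero]
        exact mul_nonneg hα (schwartzNorm_nonneg _ _)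
(the same text, compiled-when-available, is `PhantomWitnessOfPhantomFamily.lean` next to this work file in the seat folder) -/

end LoadBearing

/-! ## §4 The junk gauge group does NOT refute D1: at `Subsingleton G` the lattice data are diagonally RP

D1 carries no `IsCompactSimpleLieGroup G` hypothesis, so `G = PUnit` is an admissible instance.  It is no counterexample:
for a one-element gauge group every torus weight is deterministic, `planeDist_k n q = (∏ᵢ w_k(qᵢ)) · D_k`, with
`D_k F = Σ_{x ∈ (box L_k)ⁿ} F(a_k x)`, and the LATTICE E2 form in a diagonal frame `R` is a perfect square: the frame
reflection `R θ R⁻¹` is the signed coordinate swap `(x⁰, x¹) ↦ (τ x¹, τ x⁰)` (`τ = −2ab = ±1`), a symmetry of the cubic box,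
so `D_k(R^*(θFᵢ* ⊗ Fⱼ)) = conj(Aᵢ) Aⱼ`.  Limits of non-negative reals are non-negative reals. -/

section JunkGroup

variable {G : Type} [Group G] [TopologicalSpace G] [IsTopologicalGroup G] [CompactSpace G]
  [MeasurableSpace G] [BorelSpace G]

/-- The scaled-lattice sum functional `D F = Σ_{x ∈ (box L)ⁿ} F(c x)`. [folklore] -/
def latSum (L : ℕ) (c : ℝ) (n : ℕ) (F : 𝓢((Fin n → EuclideanSpace ℝ (Fin 4)), ℂ)) : ℂ :=
  ∑ x ∈ Fintype.piFinset (fun _ : Fin n => box 4 L), F (fun i => c • siteToE (x i))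

/-- For a one-element gauge group every torus weight is the deterministic product `∏ᵢ (Oᵢ(V₀) − mᵢ)`. [folklore] -/
theorem torusMomentStr_of_subsingleton [Subsingleton G] {N : ℕ} (ρ : G →* Matrix (Fin N) (Fin N) ℂ)
    (hρ : Continuous ρ) (β : ℝ) (L : ℕ) {n : ℕ} (O : Fin n → LGConfig 4 G → ℝ) (m : Fin n → ℝ)
    (x : Fin n → Site 4) (V₀ : LGConfig 4 G) : torusMomentStr ρ β L O m x = ∏ i, (O i V₀ - m i) := by
  haveI := isProbabilityMeasure_wilsonMeasure (d := 4) (L := 2 * L + 1) ρ hρ β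
  unfold torusMomentStr
  have hc : (fun U : GaugeConfig 4 (2 * L + 1) G =>
      ∏ i, (O i (configShift (-(x i)) (torusLift (2 * L + 1) U)) - m i)) = fun _ => ∏ i, (O i V₀ - m i) := by
    funext U
    exact Finset.prod_congr rfl fun i _ => by rw [Subsingleton.elim (configShift (-(x i)) (torusLift (2 * L + 1) U)) V₀]
  rw [hc, integral_const, smul_eq_mul, probReal_univ, one_mul]

/-- The plane weight `w_k(p) = c_k a_k⁴ (F_p(V₀) − m_k/6)` of a one-element gauge group. [folklore] -/
def planeWeight (r : LatticeRep G) (sch : SpeciesScheme (YMSpecies G)) (k : ℕ) (V₀ : LGConfig 4 G) (p : Plane) : ℝ :=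
  sch.c r.curvature k * sch.a k ^ 4 * ((planeSpecies r p).F V₀ - sch.m r.curvature k / 6)

/-- `planeDist_k n q = (∏ᵢ w_k(qᵢ)) · D_k` for a one-element gauge group. [folklore] -/
theorem planeDist_of_subsingleton [Subsingleton G] (r : LatticeRep G) (sch : SpeciesScheme (YMSpecies G)) (k n : ℕ)
    (q : Fin n → Plane) (F : 𝓢((Fin n → EuclideanSpace ℝ (Fin 4)), ℂ)) (V₀ : LGConfig 4 G) :
    planeDist r sch k n q F = ((∏ i, planeWeight r sch k V₀ (q i) : ℝ) : ℂ) * latSum (sch.L k) (sch.a k) n F := by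
  simp only [planeDist, latSum, _root_.smul_apply, latticeDistStr_apply, smul_eq_mul,
    Finset.mul_sum, torusMomentStr_of_subsingleton r.ρ r.continuous _ _ _ _ _ V₀]
  refine Finset.sum_congr rfl fun x _ => ?_
  rw [← mul_assoc, ← Complex.ofReal_mul]
  congr 2
  simp only [planeWeight]
  rw [Finset.prod_mul_distrib, Finset.prod_const, Finset.card_univ, Fintype.card_fin]

/-- Summed over all strings: `Σ_q planeDist_k n q = W_kⁿ · D_k`, `W_k = Σ_p w_k(p)`. [folklore] -/
theorem sum_planeDist_of_subsingleton [Subsingleton G] (r : LatticeRep G) (sch : SpeciesScheme (YMSpecies G))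
    (k n : ℕ) (F : 𝓢((Fin n → EuclideanSpace ℝ (Fin 4)), ℂ)) (V₀ : LGConfig 4 G) :
    ∑ q : Fin n → Plane, planeDist r sch k n q F =
      (((∑ p : Plane, planeWeight r sch k V₀ p) ^ n : ℝ) : ℂ) * latSum (sch.L k) (sch.a k) n F := by
  simp only [planeDist_of_subsingleton r sch k n _ F V₀]
  rw [← Finset.sum_mul, Finset.sum_pow', Fintype.piFinset_univ]
  push_cast
  rfl

/-- The lattice signed swap `(s⁰, s¹, s², s³) ↦ (τ s¹, τ s⁰, s², s³)`. [folklore] -/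
def sswap (τ : ℤ) (s : Site 4) : Site 4 := ![τ * s 1, τ * s 0, s 2, s 3]

omit [Group G] [TopologicalSpace G] [IsTopologicalGroup G] [CompactSpace G] [MeasurableSpace G] [BorelSpace G] in
/-- The signed swap is an involution. [folklore] -/
theorem sswap_sswap {τ : ℤ} (hτ : τ = 1 ∨ τ = -1) (s : Site 4) : sswap τ (sswap τ s) = s := by
  funext i
  fin_cases i <;> rcases hτ with rfl | rfl <;> simp [sswap]

omit [Group G] [TopologicalSpace G] [IsTopologicalGroup G] [CompactSpace G] [MeasurableSpace G] [BorelSpace G] in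
/-- The signed swap preserves the cubic box. [folklore] -/
theorem sswap_mem_box {τ : ℤ} (hτ : τ = 1 ∨ τ = -1) {L : ℕ} {s : Site 4} (hs : s ∈ box 4 L) : sswap τ s ∈ box 4 L := by
  rw [mem_box] at hs ⊢
  have h0 := hs 0; have h1 := hs 1; have h2 := hs 2; have h3 := hs 3
  intro i
  fin_cases i <;> rcases hτ with rfl | rfl <;> simp [sswap] <;> omega

omit [Group G] [TopologicalSpace G] [IsTopologicalGroup G] [CompactSpace G] [MeasurableSpace G] [BorelSpace G] in
/-- Frame time for a general diagonal frame: `(R⁻¹ p)⁰ = ⟨p, R e₀⟩ = a p⁰ + b p¹`. [folklore] -/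
theorem frame_time {R : EuclideanSpace ℝ (Fin 4) ≃ₗᵢ[ℝ] EuclideanSpace ℝ (Fin 4)} {a b : ℝ}
    (hR : R (EuclideanSpace.single 0 1) = a • EuclideanSpace.single 0 1 + b • EuclideanSpace.single 1 1)
    (p : EuclideanSpace ℝ (Fin 4)) : (R.symm p) 0 = a * p 0 + b * p 1 := by
  -- adapted from `ParityBridgeColdTraces.frame_time` (Theorems/PencilRigidityDiagonalMirrorRPRStubRpClosureDefs)
  have h1 : (R.symm p) 0 = ⟪R.symm p, EuclideanSpace.single 0 (1 : ℝ)⟫_ℝ := by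
    rw [EuclideanSpace.inner_single_right]; simp
  rw [h1, LinearIsometryEquiv.inner_map_eq_flip, LinearIsometryEquiv.symm_symm, hR, inner_add_right,
    inner_smul_right, inner_smul_right, EuclideanSpace.inner_single_right, EuclideanSpace.inner_single_right]
  simp

omit [Group G] [TopologicalSpace G] [IsTopologicalGroup G] [CompactSpace G] [MeasurableSpace G] [BorelSpace G] in
/-- The sign `τ = −2ab ∈ {±1}` of a diagonal frame. [folklore] -/
theorem exists_frame_sign {a b : ℝ} (ha : a ^ 2 = 1 / 2) (hb : b ^ 2 = 1 / 2) :
    ∃ τ : ℤ, (τ = 1 ∨ τ = -1) ∧ (τ : ℝ) = -(2 * a * b) := by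
  have h : (2 * a * b) ^ 2 = 1 := by rw [mul_pow, mul_pow, ha, hb]; norm_num
  rcases sq_eq_one_iff.1 h with h1 | h1
  · exact ⟨-1, Or.inr rfl, by rw [h1]; norm_num⟩
  · exact ⟨1, Or.inl rfl, by rw [h1]; norm_num⟩

omit [Group G] [TopologicalSpace G] [IsTopologicalGroup G] [CompactSpace G] [MeasurableSpace G] [BorelSpace G] in
/-- **Frame reflection on the lattice**: `θ ∘ R⁻¹ = R⁻¹ ∘ (signed swap)` on scaled lattice points — the frame reflection
`R θ R⁻¹` across `(R e₀)^⊥` is the signed swap `x⁰ ↔ x¹` with sign `τ = −2ab`. [folklore] -/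
theorem timeReflection_frame_lattice {R : EuclideanSpace ℝ (Fin 4) ≃ₗᵢ[ℝ] EuclideanSpace ℝ (Fin 4)} {a b : ℝ}
    (ha : a ^ 2 = 1 / 2) (hb : b ^ 2 = 1 / 2)
    (hR : R (EuclideanSpace.single 0 1) = a • EuclideanSpace.single 0 1 + b • EuclideanSpace.single 1 1)
    {τ : ℤ} (hτ : (τ : ℝ) = -(2 * a * b)) (c : ℝ) (s : Site 4) :
    timeReflection 4 (R.symm (c • siteToE s)) = R.symm (c • siteToE (sswap τ s)) := by
  apply R.injective
  rw [LinearIsometryEquiv.apply_symm_apply,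
    Summit.QuantumFields.YangMills.Cruxes.DiagonalMirrorRPR.ParityBridgeColdTraces.RpClosure.timeReflection_eq_sub, map_sub,
    LinearIsometryEquiv.apply_symm_apply, frame_time hR, LinearIsometryEquiv.map_smul]
  rw [hR]
  ext i
  fin_cases i
  · simp [sswap, siteToE_apply]
    linear_combination (-(c * (s 1 : ℝ))) * hτ - (2 * c * (s 0 : ℝ)) * ha
  · simp [sswap, siteToE_apply]
    linear_combination (-(c * (s 0 : ℝ))) * hτ - (2 * c * (s 1 : ℝ)) * hb
  · simp [sswap, siteToE_apply]
  · simp [sswap, siteToE_apply]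

omit [Group G] [TopologicalSpace G] [IsTopologicalGroup G] [CompactSpace G] [MeasurableSpace G] [BorelSpace G] in
/-- The reindexing `y ↦ (signed swap) ∘ y ∘ rev` of lattice strings, an involution. [folklore] -/
def swapRevEquiv {τ : ℤ} (hτ : τ = 1 ∨ τ = -1) (n : ℕ) : (Fin n → Site 4) ≃ (Fin n → Site 4) where
  toFun y l := sswap τ (y (Fin.rev l))
  invFun y l := sswap τ (y (Fin.rev l))
  left_inv y := funext fun l => by simp only [Fin.rev_rev, sswap_sswap hτ]
  right_inv y := funext fun l => by simp only [Fin.rev_rev, sswap_sswap hτ]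

omit [Group G] [TopologicalSpace G] [IsTopologicalGroup G] [CompactSpace G] [MeasurableSpace G] [BorelSpace G] in
/-- **The lattice E2 term in a diagonal frame factorises**: `D(R^*(θF* ⊗ G)) = conj(D(R^*F)) · D(R^*G)`, because the
frame reflection is a signed swap of the cubic box. [folklore] -/
theorem latSum_linActMulti_appendTensor {R : EuclideanSpace ℝ (Fin 4) ≃ₗᵢ[ℝ] EuclideanSpace ℝ (Fin 4)} {a b : ℝ}
    (ha : a ^ 2 = 1 / 2) (hb : b ^ 2 = 1 / 2)
    (hR : R (EuclideanSpace.single 0 1) = a • EuclideanSpace.single 0 1 + b • EuclideanSpace.single 1 1)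
    (L : ℕ) (c : ℝ) {n m : ℕ} {F : 𝓢((Fin n → EuclideanSpace ℝ (Fin 4)), ℂ)}
    {G' : 𝓢((Fin m → EuclideanSpace ℝ (Fin 4)), ℂ)} {H : 𝓢((Fin (n + m) → EuclideanSpace ℝ (Fin 4)), ℂ)}
    (hH : IsAppendTensorOf H (osAdjoint F) G') :
    latSum L c (n + m) (linActMulti R H) = conj (latSum L c n (linActMulti R F)) * latSum L c m (linActMulti R G') := by
  obtain ⟨τ, hτ, hτr⟩ := exists_frame_sign ha hb
  unfold latSum
  simp only [linActMulti_apply]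
  -- split the string sum `(box L)^{n+m} = (box L)^n × (box L)^m`
  have hsplit : ∑ x ∈ Fintype.piFinset (fun _ : Fin (n + m) => box 4 L), H (fun i => R.symm (c • siteToE (x i))) =
      ∑ p ∈ Fintype.piFinset (fun _ : Fin n => box 4 L) ×ˢ Fintype.piFinset (fun _ : Fin m => box 4 L),
        H (fun i => R.symm (c • siteToE (Fin.append p.1 p.2 i))) := by
    refine (Finset.sum_equiv (Fin.appendEquiv n m) (fun p => ?_) (fun p _ => rfl)).symm
    simp only [Finset.mem_product, Fintype.mem_piFinset, Fin.appendEquiv_apply, Fin.forall_fin_add, Fin.append_left,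
      Fin.append_right]
  rw [hsplit, Finset.sum_product]
  simp only [hH _, Function.comp_def, Fin.append_left, Fin.append_right]
  rw [← Finset.sum_mul_sum]
  congr 1
  -- the reflected factor: reindex by the signed swap composed with reversal
  rw [map_sum]
  simp only [osAdjoint_apply, timeReflection_frame_lattice ha hb hR hτr]
  refine Finset.sum_equiv (swapRevEquiv hτ n) (fun y => ?_) (fun y _ => rfl)
  simp only [Fintype.mem_piFinset]
  constructor
  · intro hy l
    exact sswap_mem_box hτ (hy _)
  · intro hy l
    have h := sswap_mem_box hτ (hy (Fin.rev l))
    simpa only [swapRevEquiv, Equiv.coe_fn_mk, Fin.rev_rev, sswap_sswap hτ] using h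

/-- **D1 HOLDS for every one-element gauge group** (every `LatticeRep`, every scheme, every `φ`, `T`; only the
convergence clause `PlaneLimits.1` is used): the junk model `G = PUnit`, which D1 does not exclude, is no refutation. [folklore] -/
theorem diagonalFrameRP_planeSum_of_subsingleton [Subsingleton G] (r : LatticeRep G) (sch : SpeciesScheme (YMSpecies G))
    (φ : ℕ → ℕ) (T : (n : ℕ) → (Fin n → Plane) → (𝓢((Fin n → EuclideanSpace ℝ (Fin 4)), ℂ) →L[ℂ] ℂ))
    (hT : PlaneLimits r sch φ T) : DiagonalFrameRP (planeSum T) := by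
  intro R a b ha hb hR N deg lab F hF H hH
  set V₀ : LGConfig 4 G := fun _ => 1
  -- the lattice E2 form at step `k` is a perfect square
  have hk : ∀ k, ∑ i, ∑ j, ∑ q : Fin (deg i + deg j) → Plane, planeDist r sch k (deg i + deg j) q (linActMulti R (H i j)) =
      conj (∑ j, (((∑ p : Plane, planeWeight r sch k V₀ p) ^ deg j : ℝ) : ℂ) *
          latSum (sch.L k) (sch.a k) (deg j) (linActMulti R (F j))) *
        ∑ j, (((∑ p : Plane, planeWeight r sch k V₀ p) ^ deg j : ℝ) : ℂ) *
          latSum (sch.L k) (sch.a k) (deg j) (linActMulti R (F j)) := by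
    intro k
    rw [map_sum, Finset.sum_mul_sum]
    refine Finset.sum_congr rfl fun i _ => Finset.sum_congr rfl fun j _ => ?_
    rw [sum_planeDist_of_subsingleton r sch k _ _ V₀, latSum_linActMulti_appendTensor ha hb hR _ _ (hH i j), pow_add]
    simp only [map_mul, Complex.conj_ofReal]
    push_cast
    ring
  have hsq : ∀ k, 0 ≤ (∑ i, ∑ j, ∑ q : Fin (deg i + deg j) → Plane,
      planeDist r sch k (deg i + deg j) q (linActMulti R (H i j))).re ∧
      (∑ i, ∑ j, ∑ q : Fin (deg i + deg j) → Plane, planeDist r sch k (deg i + deg j) q (linActMulti R (H i j))).im = 0 := by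
    intro k
    rw [hk k, mul_comm, Complex.mul_conj, Complex.ofReal_re, Complex.ofReal_im]
    exact ⟨Complex.normSq_nonneg _, rfl⟩
  -- pass to the limit along `φ`
  have hlim : Tendsto (fun k => ∑ i, ∑ j, ∑ q : Fin (deg i + deg j) → Plane,
      planeDist r sch (φ k) (deg i + deg j) q (linActMulti R (H i j))) atTop
      (𝓝 (∑ i, ∑ j, planeSum T (deg i + deg j) (linActMulti R (H i j)))) :=
    tendsto_finsetSum _ fun i _ => tendsto_finsetSum _ fun j _ =>
      hT.tendsto_planeSum _ (isOffDiagonal_linActMulti_of_isAppendTensorOf R (hF i) (hF j) (hH i j))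
  have hterm : ∀ i j, (SchwingerFamily.toLabelled (fun n => (planeSum T n).comp (linActMulti R))) (deg i + deg j)
      (Fin.append (lab i ∘ Fin.rev) (lab j)) (H i j) = planeSum T (deg i + deg j) (linActMulti R (H i j)) := fun i j => by
    rw [SchwingerFamily.toLabelled_apply, ContinuousLinearMap.comp_apply]
  simp only [hterm]
  refine ⟨ge_of_tendsto' ((Complex.continuous_re.tendsto _).comp hlim) fun k => (hsq (φ k)).1, ?_⟩
  refine tendsto_nhds_unique ((Complex.continuous_im.tendsto _).comp hlim) ?_
  have h0 : (fun k => (∑ i, ∑ j, ∑ q : Fin (deg i + deg j) → Plane,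
      planeDist r sch (φ k) (deg i + deg j) q (linActMulti R (H i j))).im) = fun _ => 0 :=
    funext fun k => (hsq (φ k)).2
  rw [Function.comp_def, h0]
  exact tendsto_const_nhds

/-- **Corollary (the junk instance of D1, by name).** D1 holds at `G = PUnit` with all its hypotheses, whatever the scheme:
weakening `IsCompactSimpleLieGroup` away costs nothing here. [folklore] -/
theorem D1_at_punit [MeasurableSpace PUnit] [BorelSpace PUnit] (r : LatticeRep PUnit)
    (sch : SpeciesScheme (YMSpecies PUnit)) (φ : ℕ → ℕ)
    (T : (n : ℕ) → (Fin n → Plane) → (𝓢((Fin n → EuclideanSpace ℝ (Fin 4)), ℂ) →L[ℂ] ℂ))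
    (hT : PlaneLimits r sch φ T) : DiagonalFrameRP (planeSum T) :=
  diagonalFrameRP_planeSum_of_subsingleton r sch φ T hT

end JunkGroup

/-! ## §5 The reshaped target D1′ = `stub_oddTorusSwapPairingLiminf` (ρ1 reshape, Sketch v2 `97b02a6fc0a363ac` :1650), verbatim -/

/-- **D1′** (`stub_oddTorusSwapPairingLiminf`, `Lines/Sketch.lean` v2 l.1650–1663, VERBATIM): for an admissible weak-coupling scheme and ANY
subsequence `φ` carrying plane limits `T`, the sub-scheme `subseq sch φ hφ` is asymptotically swap-reflection-positive on its own odd tori in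
the curvature channel (`OddTorusSwapPairingLiminf`, p827497). [folklore] -/
def D1' : Prop :=
  ∀ (G : Type) [Group G] [TopologicalSpace G] [IsTopologicalGroup G] [CompactSpace G]
    [MeasurableSpace G] [BorelSpace G] (r : LatticeRep G) (sch : SpeciesScheme (YMSpecies G))
    (φ : ℕ → ℕ) (hφ : StrictMono φ)
    (T : (n : ℕ) → (Fin n → Plane) → (𝓢((Fin n → EuclideanSpace ℝ (Fin 4)), ℂ) →L[ℂ] ℂ)),
    sch.HasWeakCouplingLimit → PolyVolume sch → PolyRenorm r sch → UniformFunctionalBoundPlanes r sch →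
      (∃ Δ C : ℝ, 0 < Δ ∧ RPSpectral r sch Δ C) → PlaneLimits r sch φ T →
      OddTorusSwapPairingLiminf r (subseq sch φ hφ)

/-- **D1 from D1′** — the proof of `diagRPOfPlaneLimits_of_stubs` (Sketch v2 :1665) with the stub replaced by the hypothesis `D1'`,
through the LANDED transfer `diagRPOfPlaneLimits_of_swapPairingLiminf` (p827255). Certifies that `D1'` is exactly the binder type the
v2 composition consumes. [folklore] -/
theorem D1_of_D1' (h : D1') : D1 := by
  intro G _ _ _ _ _ _ r sch φ hφ T hw hpv hpr hufb hgap hpl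
  have hsock := h G r sch φ hφ T hw hpv hpr hufb hgap hpl
  unfold Summit.QuantumFields.YangMills.Cruxes.DiagonalMirrorRPR.SignTwistedDiagonalTrace.OddTorusSwapPairingLiminf at hsock
  exact Summit.QuantumFields.YangMills.Theorems.WeakCouplingHypercubicLimit.TraceNormColdPressure.diagRPOfPlaneLimits_of_swapPairingLiminf
    G r sch φ hφ T hufb hpl hsock

/-- The crux by name from D1′ and S6i (v2 top composition, re-derived through the landed p825896 closure). [folklore] -/
theorem weakCouplingHypercubicLimitRP_of_D1'_of_S6i (hD1' : D1') (hcore : S6i) :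
    Summit.QuantumFields.YangMills.Theses.PencilRigidity.WeakCouplingHypercubicLimitRP :=
  Summit.QuantumFields.YangMills.Theorems.WeakCouplingHypercubicLimit.TraceNormColdPressure.weakCouplingHypercubicLimitRP_of_diagRP_of_rpCoreDisjoint
    (D1_of_D1' hD1') hcore

/-! ## §6 DECORATION: `φ`, `T`, `PlaneLimits` are inert in D1′ — D1′ is the scheme-level claim D1″ -/

section Decoration

variable {G : Type} [Group G] [TopologicalSpace G] [IsTopologicalGroup G] [CompactSpace G]
  [MeasurableSpace G] [BorelSpace G]

/-- `RPSpectral` (an `∀ᶠ k` clause) restricts to sub-schemes with the same constants. [folklore] -/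
theorem rpSpectral_subseq (r : LatticeRep G) (sch : SpeciesScheme (YMSpecies G)) (φ : ℕ → ℕ) (hφ : StrictMono φ)
    {Δ C : ℝ} (h : RPSpectral r sch Δ C) : RPSpectral r (subseq sch φ hφ) Δ C := by
  unfold RPSpectral at h ⊢
  exact hφ.tendsto_atTop.eventually h

omit [Group G] [TopologicalSpace G] [IsTopologicalGroup G] [CompactSpace G] [MeasurableSpace G] [BorelSpace G] in
/-- A real sequence that is eventually non-negative has non-negative `liminf` (including the junk value `0` of an unbounded
`liminf`). [folklore] -/
theorem liminf_nonneg_of_eventually {u : ℕ → ℝ} (h : ∀ᶠ k in atTop, 0 ≤ u k) : 0 ≤ Filter.liminf u atTop := by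
  rw [Filter.liminf_eq]
  by_cases hS : BddAbove {a : ℝ | ∀ᶠ n in atTop, a ≤ u n}
  · exact le_csSup hS h
  · rw [Real.sSup_of_not_bddAbove hS]

omit [Group G] [TopologicalSpace G] [IsTopologicalGroup G] [CompactSpace G] [MeasurableSpace G] [BorelSpace G] in
/-- **Subsequence principle for `0 ≤ liminf`.** If every subsequence of a real sequence has a further subsequence with non-negative
`liminf`, the sequence has non-negative `liminf` (contrapositive: `liminf u < 0` gives a subsequence frequently below `liminf u / 2`,
all of whose subsequences have `liminf ≤ liminf u / 2 < 0`; the junk value of an unbounded-below `liminf` is `0`). [folklore] -/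
theorem liminf_nonneg_of_subseq {u : ℕ → ℝ}
    (h : ∀ ψ : ℕ → ℕ, StrictMono ψ → ∃ φ : ℕ → ℕ, StrictMono φ ∧ 0 ≤ Filter.liminf (u ∘ ψ ∘ φ) atTop) :
    0 ≤ Filter.liminf u atTop := by
  by_contra hneg
  push Not at hneg
  have hlim : Filter.liminf u atTop = sSup {a : ℝ | ∀ᶠ n in atTop, a ≤ u n} := Filter.liminf_eq
  have hbdd : BddAbove {a : ℝ | ∀ᶠ n in atTop, a ≤ u n} := by
    by_contra hS
    rw [hlim, Real.sSup_of_not_bddAbove hS] at hneg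
    exact lt_irrefl _ hneg
  have hne : {a : ℝ | ∀ᶠ n in atTop, a ≤ u n}.Nonempty := by
    by_contra hS
    rw [Set.not_nonempty_iff_eq_empty] at hS
    rw [hlim, hS, Real.sSup_empty] at hneg
    exact lt_irrefl _ hneg
  obtain ⟨b, hb⟩ := hne
  have hfreq : ∃ᶠ n in atTop, u n < Filter.liminf u atTop / 2 := by
    by_contra hnot
    have hmem : Filter.liminf u atTop / 2 ∈ {a : ℝ | ∀ᶠ n in atTop, a ≤ u n} :=
      (Filter.not_frequently.1 hnot).mono fun n hn => not_lt.1 hn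
    have := le_csSup hbdd hmem
    rw [← hlim] at this
    linarith
  obtain ⟨ψ, hψ, hψc⟩ := Filter.extraction_of_frequently_atTop hfreq
  obtain ⟨φ, hφ, hpos⟩ := h ψ hψ
  have hbdd' : Filter.IsBoundedUnder (· ≥ ·) atTop (u ∘ ψ ∘ φ) :=
    ⟨b, Filter.eventually_map.2 ((hψ.tendsto_atTop.comp hφ.tendsto_atTop).eventually hb)⟩
  have hle : Filter.liminf (u ∘ ψ ∘ φ) atTop ≤ Filter.liminf u atTop / 2 :=
    Filter.liminf_le_of_frequently_le (Filter.Eventually.of_forall fun n => (hψc (φ n)).le).frequently hbdd'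
  linarith

/-- **D1″** — D1′ with the inert data removed: EVERY admissible weak-coupling scheme is asymptotically swap-reflection-positive on its
own odd tori along the FULL sequence. No subsequence, no limit family, no `PlaneLimits`. [folklore] -/
def D1'' : Prop :=
  ∀ (G : Type) [Group G] [TopologicalSpace G] [IsTopologicalGroup G] [CompactSpace G]
    [MeasurableSpace G] [BorelSpace G] (r : LatticeRep G) (sch : SpeciesScheme (YMSpecies G)),
    sch.HasWeakCouplingLimit → PolyVolume sch → PolyRenorm r sch → UniformFunctionalBoundPlanes r sch →
      (∃ Δ C : ℝ, 0 < Δ ∧ RPSpectral r sch Δ C) → OddTorusSwapPairingLiminf r sch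

/-- D1″ ⇒ D1′: all five scheme hypotheses pass to the sub-scheme `subseq sch φ hφ`; `T` and `PlaneLimits` are not used. [folklore] -/
theorem D1'_of_D1'' (h : D1'') : D1' := by
  intro G _ _ _ _ _ _ r sch φ hφ T hw hpv hpr hufb hgap _hpl
  obtain ⟨Δ, C, hΔ, hrp⟩ := hgap
  exact h G r (subseq sch φ hφ) (hasWeakCouplingLimit_subseq sch φ hφ hw) (polyVolume_subseq sch φ hφ hpv)
    (polyRenorm_subseq r sch φ hφ hpr) (uniformFunctionalBoundPlanes_subseq r sch φ hφ hufb)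
    ⟨Δ, C, hΔ, rpSpectral_subseq r sch φ hφ hrp⟩

/-- D1′ ⇒ D1″: by the subsequence principle, it suffices that every sub-scheme `subseq sch ψ hψ` has a further sub-scheme on which
the pairing has non-negative `liminf`; the LANDED `stub_planeLimits` (Z2, from `UniformFunctionalBoundPlanes`) supplies `φ, T` with
`PlaneLimits r (subseq sch ψ hψ) φ T`, and D1′ applies to the sub-scheme (all hypotheses restrict). [folklore] -/
theorem D1''_of_D1' (h : D1') : D1'' := by
  intro G _ _ _ _ _ _ r sch hw hpv hpr hufb hgap m n c f σf hf hdisj hσ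
  obtain ⟨Δ, C, hΔ, hrp⟩ := hgap
  apply liminf_nonneg_of_subseq
  intro ψ hψ
  obtain ⟨φ, hφ, T, hpl⟩ := stub_planeLimits G r (subseq sch ψ hψ) (uniformFunctionalBoundPlanes_subseq r sch ψ hψ hufb)
  have hsock := h G r (subseq sch ψ hψ) φ hφ T (hasWeakCouplingLimit_subseq sch ψ hψ hw) (polyVolume_subseq sch ψ hψ hpv)
    (polyRenorm_subseq r sch ψ hψ hpr) (uniformFunctionalBoundPlanes_subseq r sch ψ hψ hufb)
    ⟨Δ, C, hΔ, rpSpectral_subseq r sch ψ hψ hrp⟩ hpl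
  exact ⟨φ, hφ, hsock m n c f σf hf hdisj hσ⟩

/-- **D1′ ⟺ D1″.** The subsequence `φ`, the limit family `T` and `PlaneLimits` are DECORATION in D1′: the target is the scheme-level
statement D1″. Consequence for disprovers and provers alike: a counterexample to / proof of D1′ is a counterexample to / proof of own-torus
asymptotic swap-RP for admissible schemes, nothing about continuum limits. [folklore] -/
theorem D1'_iff_D1'' : D1' ↔ D1'' := ⟨D1''_of_D1', D1'_of_D1''⟩

end Decoration

/-! ## §7 The junk gauge group does NOT refute D1′ either: at `Subsingleton G` the swap pairing is a perfect square -/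

section JunkGroupSwap

variable {G : Type} [Group G] [TopologicalSpace G] [IsTopologicalGroup G] [CompactSpace G]
  [MeasurableSpace G] [BorelSpace G]

/-- For a one-element gauge group the curvature `n`-point function is the deterministic product of the one-point smearings at the
unique configuration. [folklore] -/
theorem latticeSchwinger_of_subsingleton [Subsingleton G] (r : LatticeRep G) (sch : SpeciesScheme (YMSpecies G)) (k n : ℕ)
    (u : Fin n → 𝓢(E4, ℝ)) (V₀ : LGConfig 4 G) :
    latticeSchwinger r.ρ sch (fun s => s.F) k n (fun _ => r.curvature) u =
      ∏ i, smearedLatticeField r.curvature.F (box 4 (sch.L k)) (sch.a k) (sch.c r.curvature k) (sch.m r.curvature k)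
        (u i) V₀ := by
  haveI := isProbabilityMeasure_wilsonMeasure (d := 4) (L := sch.side k) r.ρ r.continuous (sch.β k)
  unfold latticeSchwinger
  have hc : (fun U : GaugeConfig 4 (sch.side k) G => ∏ i, smearedLatticeField ((fun s : YMSpecies G => s.F)
      ((fun _ : Fin n => r.curvature) i)) (box 4 (sch.L k)) (sch.a k) (sch.c ((fun _ : Fin n => r.curvature) i) k)
      (sch.m ((fun _ : Fin n => r.curvature) i) k) (u i) (torusLift (sch.side k) U)) =
      fun _ => ∏ i, smearedLatticeField r.curvature.F (box 4 (sch.L k)) (sch.a k) (sch.c r.curvature k)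
        (sch.m r.curvature k) (u i) V₀ := by
    funext U
    exact Finset.prod_congr rfl fun i _ => by rw [Subsingleton.elim (torusLift (sch.side k) U) V₀]
  rw [hc, integral_const, smul_eq_mul, probReal_univ, one_mul]

/-- At a one-element gauge group the `n`-point function of an appended string factorises. [folklore] -/
theorem latticeSchwinger_append_of_subsingleton [Subsingleton G] (r : LatticeRep G) (sch : SpeciesScheme (YMSpecies G))
    (k : ℕ) {n n' : ℕ} (u : Fin n → 𝓢(E4, ℝ)) (u' : Fin n' → 𝓢(E4, ℝ)) :
    latticeSchwinger r.ρ sch (fun s => s.F) k (n + n') (fun _ => r.curvature) (Fin.append u u') =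
      latticeSchwinger r.ρ sch (fun s => s.F) k n (fun _ => r.curvature) u *
        latticeSchwinger r.ρ sch (fun s => s.F) k n' (fun _ => r.curvature) u' := by
  simp only [latticeSchwinger_of_subsingleton r sch k _ _ (1 : LGConfig 4 G)]
  rw [Fin.prod_univ_add]
  simp only [Fin.append_left, Fin.append_right]

/-- The swap-mirrored string has the same `n`-point function (any gauge group): swap covariance (`latticeSchwinger_swap`, p827142)
and re-indexing by `Fin.rev`. [folklore] -/
theorem latticeSchwinger_mirror (r : LatticeRep G) (sch : SpeciesScheme (YMSpecies G)) (k : ℕ) {n : ℕ}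
    (u σu : Fin n → 𝓢(E4, ℝ)) (hσ : ∀ j x, σu j x = u (Fin.rev j) (swap01 x)) :
    latticeSchwinger r.ρ sch (fun s => s.F) k n (fun _ => r.curvature) σu =
      latticeSchwinger r.ρ sch (fun s => s.F) k n (fun _ => r.curvature) u := by
  rw [latticeSchwinger_swap r sch k n (u ∘ Fin.rev) σu fun p x => hσ p x]
  exact latticeSchwinger_comp_equiv r sch k Fin.revPerm u

/-- **The junk-group door is closed for D1′ as well**: for EVERY one-element gauge group, every `LatticeRep`, every scheme, the own-torus
swap pairing of a mirrored family is the perfect square `(Σᵢ cᵢ Xᵢ)²`, `Xᵢ = ⟨∏ⱼ Φ(fᵢⱼ)⟩_k`, at every step `k`; hence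
`OddTorusSwapPairingLiminf r sch` HOLDS (no hypothesis of D1′ needed). [folklore] -/
theorem oddTorusSwapPairingLiminf_of_subsingleton [Subsingleton G] (r : LatticeRep G) (sch : SpeciesScheme (YMSpecies G)) :
    OddTorusSwapPairingLiminf r sch := by
  intro m n c f σf _hf _hdisj hσ
  refine liminf_nonneg_of_eventually (Filter.Eventually.of_forall fun k => ?_)
  have hsq : ∑ i, ∑ i', c i * c i' *
      latticeSchwinger r.ρ sch (fun s => s.F) k (n i + n i') (fun _ => r.curvature) (Fin.append (σf i) (f i')) =
      (∑ i, c i * latticeSchwinger r.ρ sch (fun s => s.F) k (n i) (fun _ => r.curvature) (f i)) ^ 2 := by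
    rw [sq, Finset.sum_mul_sum]
    refine Finset.sum_congr rfl fun i _ => Finset.sum_congr rfl fun i' _ => ?_
    rw [latticeSchwinger_append_of_subsingleton, latticeSchwinger_mirror r sch k (f i) (σf i) (hσ i)]
    ring
  rw [hsq]
  exact sq_nonneg _

/-- Hence D1″ (equivalently D1′) HOLDS at every one-element gauge group, whatever the scheme: the binder `G` of D1′ (no
`IsCompactSimpleLieGroup G`) is not exploitable. [folklore] -/
theorem D1''_at_subsingleton [Subsingleton G] (r : LatticeRep G) (sch : SpeciesScheme (YMSpecies G)) :
    sch.HasWeakCouplingLimit → PolyVolume sch → PolyRenorm r sch → UniformFunctionalBoundPlanes r sch →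
      (∃ Δ C : ℝ, 0 < Δ ∧ RPSpectral r sch Δ C) → OddTorusSwapPairingLiminf r sch :=
  fun _ _ _ _ _ => oddTorusSwapPairingLiminf_of_subsingleton r sch

/-- … and D1′'s conclusion holds at every one-element gauge group for every `φ`. [folklore] -/
theorem D1'_at_subsingleton [Subsingleton G] (r : LatticeRep G) (sch : SpeciesScheme (YMSpecies G)) (φ : ℕ → ℕ)
    (hφ : StrictMono φ) : OddTorusSwapPairingLiminf r (subseq sch φ hφ) :=
  oddTorusSwapPairingLiminf_of_subsingleton r (subseq sch φ hφ)

end JunkGroupSwap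

/-! ## §8 (g3) Door B's LETTERS at the junk gauge group: `TwistLetters r sch` holds at every one-element `G` -/

section LettersJunkB

open Summit.QuantumFields.YangMills.Cruxes.DiagonalMirrorRPR.SignTwistedDiagonalTrace
open Summit.QuantumFields.YangMills.Theorems.WeakCouplingHypercubicLimitRP.Negative.OddTorusSwapPairingLiminf
  (swapPairing_eq_sq_of_subsingleton)

variable {G : Type} [Group G] [TopologicalSpace G] [IsTopologicalGroup G] [CompactSpace G]
  [MeasurableSpace G] [BorelSpace G]

/-- At a one-element gauge group the Gram pairing of a reflected family is the square of its observable (at any configuration):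
the landed `swapPairing_eq_sq_of_subsingleton` (p828406) + factorisation. [folklore] -/
theorem gramPairing_eq_sq_of_subsingleton [Subsingleton G] (r : LatticeRep G) (sch : SpeciesScheme (YMSpecies G))
    (F : ReflectedFamily) (k : ℕ) (V₀ : LGConfig 4 G) :
    gramPairing r sch F k = (famObs r sch F k V₀) ^ 2 := by
  unfold gramPairing famObs
  rw [swapPairing_eq_sq_of_subsingleton r sch k F.n F.c F.f F.σf F.mirror]
  congr 1
  refine Finset.sum_congr rfl fun i _ => ?_
  rw [latticeSchwinger_of_subsingleton r sch k _ _ V₀]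

/-- Hence the Gram pairing is non-negative at EVERY step (one-element gauge group; contrast census v2 (b): for nonabelian `G` the
finite-`k` pairing can be negative by the seam). [folklore] -/
theorem gramPairing_nonneg_of_subsingleton [Subsingleton G] (r : LatticeRep G) (sch : SpeciesScheme (YMSpecies G))
    (F : ReflectedFamily) (k : ℕ) : 0 ≤ gramPairing r sch F k := by
  rw [gramPairing_eq_sq_of_subsingleton r sch F k (fun _ => 1)]
  exact sq_nonneg _

/-- … and dominated by the square of any sup bound of the family observable. [folklore] -/
theorem gramPairing_le_sq_of_subsingleton [Subsingleton G] (r : LatticeRep G) (sch : SpeciesScheme (YMSpecies G))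
    (F : ReflectedFamily) (k : ℕ) {B : ℝ} (hB : ∀ V, |famObs r sch F k V| ≤ B) : gramPairing r sch F k ≤ B ^ 2 := by
  rw [gramPairing_eq_sq_of_subsingleton r sch F k (fun _ => 1), ← sq_abs]
  exact pow_le_pow_left₀ (abs_nonneg _) (hB _) 2

omit [Group G] [TopologicalSpace G] [IsTopologicalGroup G] [CompactSpace G] [MeasurableSpace G] [BorelSpace G] in
/-- `Σ' j, δ_{j0}^n · w_j = w_0` for a weight `w` vanishing off `0`. [folklore] -/
theorem tsum_indicator_pow_mul (n : ℕ) (g : ℝ) :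
    ∑' j : ℕ, (if j = 0 then (1 : ℝ) else 0) ^ n * (if j = 0 then g else 0) = g := by
  have h : (fun j : ℕ => (if j = 0 then (1 : ℝ) else 0) ^ n * (if j = 0 then g else 0)) =
      fun j => if j = 0 then g else 0 := by
    funext j
    split_ifs with hj
    · rw [one_pow, one_mul]
    · rw [mul_zero]
  rw [h]
  exact tsum_ite_eq 0 (fun _ => g)

omit [Group G] [TopologicalSpace G] [IsTopologicalGroup G] [CompactSpace G] [MeasurableSpace G] [BorelSpace G] in
/-- `Σ' j, δ_{j0}^n = 1` for `n ≠ 0`. [folklore] -/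
theorem tsum_indicator_pow {n : ℕ} (hn : n ≠ 0) : ∑' j : ℕ, (if j = 0 then (1 : ℝ) else 0) ^ n = 1 := by
  have h : (fun j : ℕ => (if j = 0 then (1 : ℝ) else 0) ^ n) = fun j => if j = 0 then (1 : ℝ) else 0 := by
    funext j
    split_ifs
    · rw [one_pow]
    · rw [zero_pow hn]
  rw [h]
  exact tsum_ite_eq 0 (fun _ => (1 : ℝ))

omit [Group G] [TopologicalSpace G] [IsTopologicalGroup G] [CompactSpace G] [MeasurableSpace G] [BorelSpace G] in
/-- `Σ' j, 0^n = 0` for `n ≠ 0`. [folklore] -/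
theorem tsum_zero_pow {n : ℕ} (hn : n ≠ 0) : ∑' _j : ℕ, (0 : ℝ) ^ n = 0 := by
  rw [zero_pow hn, tsum_zero]

omit [TopologicalSpace G] [IsTopologicalGroup G] [CompactSpace G] [BorelSpace G] in
/-- Eventually the torus has at least three diagonal slices (`L_k ≥ 1`, from `a_k L_k → ∞` and `a_k → 0`). [folklore] -/
theorem eventually_three_le_side (sch : SpeciesScheme (YMSpecies G)) : ∀ᶠ k in atTop, 3 ≤ sch.side k := by
  have h1 : ∀ᶠ k in atTop, (1 : ℝ) ≤ sch.a k * sch.L k := sch.tendsto_L.eventually_ge_atTop 1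
  have ha1 : ∀ᶠ k in atTop, sch.a k ≤ 1 := sch.tendsto_a.eventually (eventually_le_nhds one_pos)
  filter_upwards [h1, ha1] with k hk hk1
  have hL : (1 : ℝ) ≤ sch.L k := by
    by_contra hlt
    rw [not_le] at hlt
    have : sch.a k * (sch.L k : ℝ) < 1 * 1 := mul_lt_mul' hk1 hlt (Nat.cast_nonneg _) one_pos
    linarith
  have hL' : 1 ≤ sch.L k := by exact_mod_cast hL
  simp only [SpeciesScheme.side]
  omega

/-- **The rank-one vacuum slice model** at a one-element gauge group: even sector = ONE mode of modulus `1` (the top; `sp k = δ₀`),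
odd sector EMPTY (`sm ≡ 0`), Gram weight of a family = its Gram pairing on the top mode (`wp F k = δ₀ · gramPairing`, non-negative by
`gramPairing_nonneg_of_subsingleton`), `wm ≡ 0`, depth `≡ 1` (NOT `0`: at `t = 0` the junk value `∑' j, (sp k j)^0 = 0` of a
non-summable series would make `weight_dom` demand `gramPairing ≤ 0`).  `pairing_eq` is the identity `gramPairing = 1^{S} · gramPairing`
once `3 ≤ S_k`; `weight_dom` is `gramPairing ≤ B²` (`gramPairing_le_sq_of_subsingleton`). [folklore] -/
def vacuumSliceModel [Subsingleton G] (r : LatticeRep G) (sch : SpeciesScheme (YMSpecies G)) : DiagonalSliceModel r sch where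
  sp := fun _ j => if j = 0 then 1 else 0
  sm := fun _ _ => 0
  top := fun _ => 1
  top_pos := fun _ => one_pos
  sp_nonneg := fun _ j => by
    split_ifs
    · exact zero_le_one
    · exact le_rfl
  sm_nonneg := fun _ _ => le_rfl
  sp_le := fun _ j => by
    split_ifs
    · exact le_rfl
    · exact zero_le_one
  sm_le := fun _ _ => zero_le_one
  top_attained := fun _ => ⟨0, Or.inl (if_pos rfl)⟩
  summable_sp := fun _ => by
    have h : (fun j : ℕ => (if j = 0 then (1 : ℝ) else 0) ^ 2) = fun j => if j = 0 then (1 : ℝ) else 0 := by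
      funext j; split_ifs <;> norm_num
    rw [h]
    exact (hasSum_ite_eq 0 1).summable
  summable_sm := fun _ => by
    simp only [ne_eq, OfNat.ofNat_ne_zero, not_false_eq_true, zero_pow]
    exact summable_zero
  trace_nonneg := fun _ m hm _ => by
    rw [tsum_zero_pow (by omega), tsum_indicator_pow (by omega)]
    exact zero_le_one
  trace_side_pos := fun k => by
    have hs : sch.side k ≠ 0 := Nat.succ_ne_zero _
    rw [tsum_zero_pow hs, tsum_indicator_pow hs]
    exact one_pos
  wp := fun F k j => if j = 0 then gramPairing r sch F k else 0
  wm := fun _ _ _ => 0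
  wp_nonneg := fun F k j => by
    split_ifs
    · exact gramPairing_nonneg_of_subsingleton r sch F k
    · exact le_rfl
  wm_nonneg := fun _ _ _ => le_rfl
  w_bdd := fun F k => ⟨gramPairing r sch F k, fun j => ⟨by
    split_ifs
    · exact le_rfl
    · exact gramPairing_nonneg_of_subsingleton r sch F k, gramPairing_nonneg_of_subsingleton r sch F k⟩⟩
  depth := fun _ _ => 1
  depth_le := fun _ => ⟨1, by
    filter_upwards [sch.tendsto_a.eventually (eventually_le_nhds one_pos)] with k hk
    simpa using hk⟩
  pairing_eq := fun F => by
    filter_upwards [eventually_three_le_side sch] with k hk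
    refine ⟨by omega, ?_⟩
    have hs : sch.side k ≠ 0 := Nat.succ_ne_zero _
    rw [tsum_zero_pow hs, tsum_indicator_pow hs, tsum_indicator_pow_mul]
    simp only [mul_zero, tsum_zero, sub_zero, mul_one]
  weight_dom := fun F => by
    refine Filter.Eventually.of_forall fun k t B hB => ?_
    rw [tsum_indicator_pow_mul]
    simp only [mul_zero, tsum_zero, add_zero]
    have h2 : 2 * t + 2 * 1 ≠ 0 := by omega
    rw [tsum_zero_pow h2, tsum_indicator_pow h2, add_zero, mul_one]
    exact gramPairing_le_sq_of_subsingleton r sch F k hB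

/-- R1 `OddTwistGap` holds for the vacuum model with `μ = 1` (the odd sector is empty). [folklore] -/
theorem oddTwistGap_vacuumSliceModel [Subsingleton G] (r : LatticeRep G) (sch : SpeciesScheme (YMSpecies G)) :
    OddTwistGap (vacuumSliceModel r sch) :=
  ⟨1, one_pos, Filter.Eventually.of_forall fun k j => by
    show (0 : ℝ) ≤ Real.exp (-(1 * sch.a k)) * 1
    rw [mul_one]; exact (Real.exp_pos _).le⟩

/-- R2 `DiagLukewarm` holds for the vacuum model with `θ = 1/4`, `C = 1` (normalised heat trace `= 1` at every depth `t ≥ 1`). [folklore] -/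
theorem diagLukewarm_vacuumSliceModel [Subsingleton G] (r : LatticeRep G) (sch : SpeciesScheme (YMSpecies G)) :
    DiagLukewarm (vacuumSliceModel r sch) := by
  refine ⟨1 / 4, by norm_num, by norm_num, 1, ?_⟩
  filter_upwards [eventually_three_le_side sch] with k hk t ht
  have ht1 : 1 ≤ t := by
    have h3 : (3 : ℝ) ≤ sch.side k := by exact_mod_cast hk
    have : (0 : ℝ) < t := lt_of_lt_of_le (by linarith) ht
    exact_mod_cast this
  have h2t : 2 * t ≠ 0 := by omega
  show ∑' j : ℕ, ((if j = 0 then (1 : ℝ) else 0) / 1) ^ (2 * t) + ∑' _j : ℕ, ((0 : ℝ) / 1) ^ (2 * t) ≤ 1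
  simp only [div_one]
  rw [tsum_indicator_pow h2t, tsum_zero_pow h2t, add_zero]

/-- **Door-B letters hold at every one-element gauge group** (every `LatticeRep`, every scheme): `TwistLetters r sch`.  The binder `G`
of D1″ (no `IsCompactSimpleLieGroup G`) separates neither the socket (§7) nor the letters from truth. [folklore] -/
theorem twistLetters_of_subsingleton [Subsingleton G] (r : LatticeRep G) (sch : SpeciesScheme (YMSpecies G)) :
    TwistLetters r sch :=
  ⟨vacuumSliceModel r sch, oddTwistGap_vacuumSliceModel r sch, diagLukewarm_vacuumSliceModel r sch⟩

end LettersJunkB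

/-! ## §9 (g3) Door C's LETTER at the junk gauge group: `AdmissibleCubeDecoupling r sch` holds at every one-element `G` -/

section LettersJunkC

open Summit.QuantumFields.YangMills.Cruxes.DiagonalMirrorRPR.SignTwistedDiagonalTrace
open Summit.QuantumFields.YangMills.Cruxes.DiagonalMirrorRPR.CubeSurgery

variable {G : Type} [Group G] [TopologicalSpace G] [IsTopologicalGroup G] [CompactSpace G]
  [MeasurableSpace G] [BorelSpace G]

/-- At a one-element gauge group the free-cube `n`-point function equals the torus one (both measures are probability measures —
`isProbabilityMeasure_cubeMeasure`, p828509 — and the integrand is the constant `∏ᵢ Φ(uᵢ)(V₀)`). [folklore] -/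
theorem cubeLatticeSchwinger_eq_of_subsingleton [Subsingleton G] (r : LatticeRep G) (sch : SpeciesScheme (YMSpecies G))
    (R : ℕ → ℕ) (k n : ℕ) (u : Fin n → 𝓢(E4, ℝ)) :
    cubeLatticeSchwinger r.ρ sch R (fun s => s.F) k n (fun _ => r.curvature) u =
      latticeSchwinger r.ρ sch (fun s => s.F) k n (fun _ => r.curvature) u := by
  set V₀ : LGConfig 4 G := fun _ => 1
  rw [latticeSchwinger_of_subsingleton r sch k n u V₀]
  haveI := isProbabilityMeasure_cubeMeasure (G := G) r.ρ r.continuous (sch.β k) (sch.side k) (R k)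
  unfold cubeLatticeSchwinger
  have hc : (fun U : GaugeConfig 4 (sch.side k) G => ∏ i, smearedLatticeField ((fun s : YMSpecies G => s.F)
      ((fun _ : Fin n => r.curvature) i)) (box 4 (sch.L k)) (sch.a k) (sch.c ((fun _ : Fin n => r.curvature) i) k)
      (sch.m ((fun _ : Fin n => r.curvature) i) k) (u i) (torusLift (sch.side k) U)) =
      fun _ => ∏ i, smearedLatticeField r.curvature.F (box 4 (sch.L k)) (sch.a k) (sch.c r.curvature k)
        (sch.m r.curvature k) (u i) V₀ := by
    funext U
    exact Finset.prod_congr rfl fun i _ => by rw [Subsingleton.elim (torusLift (sch.side k) U) V₀]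
  rw [hc, integral_const, smul_eq_mul, probReal_univ, one_mul]

/-- Hence the free-cube and torus Gram pairings coincide at every step (one-element gauge group). [folklore] -/
theorem cubeGramPairing_eq_of_subsingleton [Subsingleton G] (r : LatticeRep G) (sch : SpeciesScheme (YMSpecies G))
    (R : ℕ → ℕ) (F : ReflectedFamily) (k : ℕ) : cubeGramPairing r sch R F k = gramPairing r sch F k := by
  unfold cubeGramPairing gramPairing
  simp only [cubeLatticeSchwinger_eq_of_subsingleton]

/-- `CubeDecoupling r sch R` holds at every one-element gauge group, for EVERY radius sequence `R` (the difference is `≡ 0`). [folklore] -/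
theorem cubeDecoupling_of_subsingleton [Subsingleton G] (r : LatticeRep G) (sch : SpeciesScheme (YMSpecies G))
    (R : ℕ → ℕ) : CubeDecoupling r sch R := by
  intro F _
  simp only [cubeGramPairing_eq_of_subsingleton, sub_self]
  exact tendsto_const_nhds

/-- **Door-C letter holds at every one-element gauge group**: `AdmissibleCubeDecoupling r sch`, with `R = L` (admissible by the scheme
axiom `a_k L_k → ∞`). [folklore] -/
theorem admissibleCubeDecoupling_of_subsingleton [Subsingleton G] (r : LatticeRep G) (sch : SpeciesScheme (YMSpecies G)) :
    AdmissibleCubeDecoupling r sch :=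
  ⟨sch.L, fun _ => le_rfl, sch.tendsto_L, cubeDecoupling_of_subsingleton r sch sch.L⟩

end LettersJunkC

/-! ## §10 (g3) Everything below the crux at once at `(PUnit, punitRep, weakScheme)`; both doors' pipelines composed there -/

section LettersJoint

open Summit.QuantumFields.YangMills.Cruxes.DiagonalMirrorRPR.SignTwistedDiagonalTrace
open Summit.QuantumFields.YangMills.Cruxes.DiagonalMirrorRPR.CubeSurgery
open Summit.QuantumFields.YangMills.Theorems.WeakCouplingHypercubicLimit.TraceNormColdPressure
  (oddTorusSwapPairingLiminf_of_twistLetters oddTorusSwapPairingLiminf_of_cubeDecoupling)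

/-- **At `(PUnit, punitRep, weakScheme)` everything but S6i's `κ₃` floor holds at once**: the five scheme-level binders of D1′/D1″
(§3), door B's letters (§8), door C's letter (§9) and the socket (§7).  So no letter and no binder–letter combination is refutable by
scheme-level / junk-group reasoning, and the landed bridges p827816 (door B) / p828702 (door C) have jointly satisfiable hypotheses. [folklore] -/
theorem letters_jointly_satisfiable_at_punit [MeasurableSpace PUnit] [BorelSpace PUnit] :
    ∃ (r : LatticeRep PUnit) (sch : SpeciesScheme (YMSpecies PUnit)),
      sch.HasWeakCouplingLimit ∧ PolyVolume sch ∧ PolyRenorm r sch ∧ UniformFunctionalBoundPlanes r sch ∧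
      (∃ Δ C : ℝ, 0 < Δ ∧ RPSpectral r sch Δ C) ∧
      TwistLetters r sch ∧ AdmissibleCubeDecoupling r sch ∧ OddTorusSwapPairingLiminf r sch :=
  ⟨punitRep, weakScheme _, hasWeakCouplingLimit_weakScheme _, polyVolume_weakScheme _, polyRenorm_weakScheme _,
    uniformFunctionalBoundPlanes_weakScheme _, ⟨1, 0, one_pos, rpSpectral_of_subsingleton _ _ 1⟩,
    twistLetters_of_subsingleton _ _, admissibleCubeDecoupling_of_subsingleton _ _, oddTorusSwapPairingLiminf_of_subsingleton _ _⟩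

/-- The DOOR-B pipeline composed at the junk instance: the landed bridge `oddTorusSwapPairingLiminf_of_twistLetters` (p827816/p828264)
applied to the vacuum model's letters and the junk binders gives the socket for `(punitRep-type r, weakScheme)`. [folklore] -/
theorem socket_via_doorB_at_punit [MeasurableSpace PUnit] [BorelSpace PUnit] (r : LatticeRep PUnit) :
    OddTorusSwapPairingLiminf r (weakScheme (YMSpecies PUnit)) :=
  oddTorusSwapPairingLiminf_of_twistLetters r _ (twistLetters_of_subsingleton r _) (polyRenorm_weakScheme r)
    (uniformFunctionalBoundPlanes_weakScheme r) (polyVolume_weakScheme _)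

/-- The DOOR-C pipeline composed at the junk instance: the landed bridge `oddTorusSwapPairingLiminf_of_cubeDecoupling` (p828702) applied
to the junk cube decoupling and `β_k = k → ∞`. [folklore] -/
theorem socket_via_doorC_at_punit [MeasurableSpace PUnit] [BorelSpace PUnit] (r : LatticeRep PUnit) :
    OddTorusSwapPairingLiminf r (weakScheme (YMSpecies PUnit)) :=
  oddTorusSwapPairingLiminf_of_cubeDecoupling r _ (hasWeakCouplingLimit_weakScheme _)
    (admissibleCubeDecoupling_of_subsingleton r _)

end LettersJoint

/-! ## §11 (g3) S6i `stub_rpCoreDisjoint`: the hypothesis `IsCompactSimpleLieGroup G` is load-bearing -/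

section S6iLoadBearing

variable {G : Type} [Group G] [TopologicalSpace G] [IsTopologicalGroup G] [CompactSpace G]
  [MeasurableSpace G] [BorelSpace G]

/-- **S6i with `IsCompactSimpleLieGroup G →` dropped**, otherwise VERBATIM (§1 `S6i`). [folklore] -/
def S6iWithoutSimple : Prop :=
  ∀ (G : Type) [Group G] [TopologicalSpace G] [IsTopologicalGroup G] [CompactSpace G]
    [MeasurableSpace G] [BorelSpace G],
    ∃ (r : LatticeRep G) (sch : SpeciesScheme (YMSpecies G)),
      sch.HasWeakCouplingLimit ∧ PolyVolume sch ∧ PolyRenorm r sch ∧ UniformFunctionalBoundPlanes r sch ∧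
      (∃ Δ C : ℝ, 0 < Δ ∧ RPSpectral r sch Δ C) ∧
      (∃ (f g h : 𝓢(EuclideanSpace ℝ (Fin 4), ℝ)) (δ : ℝ),
        Disjoint (tsupport f) (tsupport g) ∧ Disjoint (tsupport f) (tsupport h) ∧
        Disjoint (tsupport g) (tsupport h) ∧ 0 < δ ∧
        ∀ᶠ k in atTop, δ ≤
          |latticeSchwinger r.ρ sch (fun s => s.F) k 3 (fun _ => r.curvature) ![f, g, h] -
            latticeSchwinger r.ρ sch (fun s => s.F) k 1 (fun _ => r.curvature) ![f] *
              latticeSchwinger r.ρ sch (fun s => s.F) k 2 (fun _ => r.curvature) ![g, h] -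
            latticeSchwinger r.ρ sch (fun s => s.F) k 1 (fun _ => r.curvature) ![g] *
              latticeSchwinger r.ρ sch (fun s => s.F) k 2 (fun _ => r.curvature) ![f, h] -
            latticeSchwinger r.ρ sch (fun s => s.F) k 1 (fun _ => r.curvature) ![h] *
              latticeSchwinger r.ρ sch (fun s => s.F) k 2 (fun _ => r.curvature) ![f, g] +
            2 * (latticeSchwinger r.ρ sch (fun s => s.F) k 1 (fun _ => r.curvature) ![f] *
              latticeSchwinger r.ρ sch (fun s => s.F) k 1 (fun _ => r.curvature) ![g] *
              latticeSchwinger r.ρ sch (fun s => s.F) k 1 (fun _ => r.curvature) ![h])|)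

/-- Sanity: `S6iWithoutSimple` is S6i with a hypothesis removed (it implies S6i). [folklore] -/
theorem S6i_of_S6iWithoutSimple (h : S6iWithoutSimple) : S6i :=
  fun G _ _ _ _ _ _ _ => h G

/-- At a one-element gauge group the connected three-point combination of S6i's non-Gaussianity floor vanishes IDENTICALLY at every
step, for every `LatticeRep`, every scheme and all test functions (each `n`-point function is the product of its one-point functions,
`latticeSchwinger_of_subsingleton`, and `XYZ − X·YZ − Y·XZ − Z·XY + 2XYZ = 0`). [folklore] -/
theorem kappaThree_eq_zero_of_subsingleton [Subsingleton G] (r : LatticeRep G) (sch : SpeciesScheme (YMSpecies G))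
    (f g h : 𝓢(E4, ℝ)) (k : ℕ) :
    latticeSchwinger r.ρ sch (fun s => s.F) k 3 (fun _ => r.curvature) ![f, g, h] -
        latticeSchwinger r.ρ sch (fun s => s.F) k 1 (fun _ => r.curvature) ![f] *
          latticeSchwinger r.ρ sch (fun s => s.F) k 2 (fun _ => r.curvature) ![g, h] -
        latticeSchwinger r.ρ sch (fun s => s.F) k 1 (fun _ => r.curvature) ![g] *
          latticeSchwinger r.ρ sch (fun s => s.F) k 2 (fun _ => r.curvature) ![f, h] -
        latticeSchwinger r.ρ sch (fun s => s.F) k 1 (fun _ => r.curvature) ![h] *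
          latticeSchwinger r.ρ sch (fun s => s.F) k 2 (fun _ => r.curvature) ![f, g] +
        2 * (latticeSchwinger r.ρ sch (fun s => s.F) k 1 (fun _ => r.curvature) ![f] *
          latticeSchwinger r.ρ sch (fun s => s.F) k 1 (fun _ => r.curvature) ![g] *
          latticeSchwinger r.ρ sch (fun s => s.F) k 1 (fun _ => r.curvature) ![h]) = 0 := by
  simp only [latticeSchwinger_of_subsingleton r sch k _ _ (fun _ => (1 : G)), Fin.prod_univ_succ,
    Fin.prod_univ_zero, Matrix.cons_val_zero, Matrix.cons_val_succ, mul_one]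
  ring

/-- **S6i without `IsCompactSimpleLieGroup G` is false** ("any proof of S6i must use that `G` is non-trivial"): at `G = PUnit`
(compact, NOT simple — `punit_connected_not_simple`) the floored quantity is `|0|` at every step whatever `r`, `sch`, `f`, `g`, `h`
(`kappaThree_eq_zero_of_subsingleton`), so no `δ > 0` is eventually below it; every OTHER conjunct of S6i holds there
(`letters_jointly_satisfiable_at_punit`, §10): the `κ₃` floor is the unique group-sensitive conjunct of the line at the junk group. [folklore] -/
theorem rpCoreDisjoint_false_without_simple : ¬ S6iWithoutSimple := by
  intro h
  letI : MeasurableSpace PUnit := borel PUnit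
  haveI : BorelSpace PUnit := ⟨rfl⟩
  obtain ⟨r, sch, -, -, -, -, -, f, g, h', δ, -, -, -, hδ, hev⟩ := h PUnit
  obtain ⟨k, hk⟩ := hev.exists
  rw [kappaThree_eq_zero_of_subsingleton r sch f g h' k, abs_zero] at hk
  exact absurd hk (not_le.2 hδ)

end S6iLoadBearing

end Summit.QuantumFields.YangMills.Cruxes.WeakCouplingHypercubicLimitRP.Disproof

end
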